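import Mathlib
import HarnessLib
import HarnessLib.Audit
import Summits.BirchSwinnertonDyer.Statement
import Summits.BirchSwinnertonDyer.BirchSwinnertonDyer.Theorems.AdditiveBranchIMCInputs
import Summits.BirchSwinnertonDyer.BirchSwinnertonDyer.Theorems.AdditiveBranchIMCGordTwoRankOneCM
import HarnessLib.Audit.Status.Attr

/-!
Route: AdditiveBranchIMC

# Route AdditiveBranchIMC — Lower half of BSD(E,p) at additive ordinary primes via the
twisted-branch main conjecture

It suffices to show X = (the main-conjecture `⊆ (𝓛)` direction on the `ω^{(p−1)/2}`-branch delivers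
`ord_p #Ш_an ≤ ord_p #Ш` on each cell of the additive potentially ordinary / multiplicative locus in
analytic rank ≤ 1): X = X₀ ∧ X₂ ∧ X₃ ∧ X₄ ∧ X₅ with X₀ = the reducible Kodaira-I₀* rows with a
Case-1 member from PUBLISHED inputs (Greenberg–Vatsal transport along the quadratic twist, Delbourgo
1998 exact formula with the local tower kernel killed by the tree; support items PrintedFacts,
X3CaseOneRankZero, and the crux ReadingFacts = the four end-state inputs that are READINGS of a
printed theorem at an additive prime), X₂ = the I₀* rank-0 rows with no Case-1 member (the
additive-branch IMC lower bound proper; crux GordTwoRankZeroOffCaseOne), X₃ = the I₀* rank-1 rows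
(Λ-adic lower bound + p-adic Gross–Zagier on the branch; crux GordTwoRankOne), X₄ = the potentially
multiplicative rows ((M)-measure; crux MultLower), X₅ = the defect-3,4,6 corner (declared residual;
crux GordHigherLower). The rung leaf `AdditiveOrdinaryLowerHalf` (= `N10.LowerHalf ∧ O7.LowerHalf`)
follows by the cell decomposition `N10.locus_iff_cells` and excluded middle on `HasCaseOneMember`.
Lean: `PrintedFacts ∧ ReadingFacts ∧ X3CaseOneRankZero ∧ GordTwoRankZeroOffCaseOne ∧ GordTwoRankOne
∧ MultLower ∧ GordHigherLower`

## Assembly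
Pure logic over the seven items: given W, p with analytic rank ≤ 1 on the N10 locus, split the locus
into its three cells (`N10.locus_iff_cells`); cell (M) → MultLower; cell (G-ord, e ∈ {3,4,6}) →
GordHigherLower; cell (G-ord, e = 2): analytic rank 1 → GordTwoRankOne, analytic rank 0 → excluded
middle on `HasCaseOneMember W p`: yes → X3CaseOneRankZero applied to PrintedFacts and ReadingFacts,
no → GordTwoRankZeroOffCaseOne. The deciding theorem `closes` (glue.lean) =
`Theorems.AdditiveBranchIMCInputs.additiveOrdinaryLowerHalf_of_inputs (h₁ h₀ h₀') h₂ h₃ h₄ h₅` — the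
Theorems-side BRIDGE (director-bsd 2026-08-25T19:23:15Z pattern: the five inputs are spelled inline
there and are definitionally the route's items; the bridge imports the Rank1Residual leaf, which a
route file may not) — and concludes the registered leaf `AdditiveOrdinaryLowerHalf` (D-0061
`--closes-target`).

CLOSES_TARGET: closes rung K1 of BirchSwinnertonDyer: Summit.BirchSwinnertonDyer.Rank1Residual.Additive.AdditiveOrdinaryLowerHalf (D-0061; not the summit Statement) — the deciding theorem of this route concludes that registered leaf instead of the Statement decl `BirchSwinnertonDyer` (class rung: servable and labelled, never counted as concluding the summit Statement).

Rationale: WHY THIS LINE. At an odd additive prime p where E is potentially ordinary, E is (for defect e = 2)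
the χ_{p*}-twist of a curve V good ordinary or multiplicative at p, and the p-part of BSD for E is
governed by the ω^{(p−1)/2}-branch of the two-variable p-adic L-function / Selmer group of V over
ℚ(μ_{p^∞}) (Delbourgo1998 Main Conjecture p. 151, Thm 3 + Prop 4; Delbourgo2002 Thms (A)–(D)); the
UPPER half of BSD(E,p) on these rows is already a kernel theorem from Kato2004Asterisque Thm 17.4
(3) for V over ℚ(ζ_{p^∞}) (all branches) / Thm 14.5 (3) for E at a potentially good p / Wuthrich2014
Thm 16, so the rung is exactly the LOWER half = the `⊆ (𝓛)` direction. On the reducible rows the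
line imports Greenberg–Vatsal's μ = 0 / λ-comparison mechanism (GreenbergVatsal2000 Thm (3.12),
GreenbergLNM1716 Props 2.2/2.4/4.14) transported along the quadratic twist to the branch: this part
is DONE in the tree modulo published facts (twist end states p401882/p402517/p403617 and the
intrinsic versions, 685 + 139 Case-1 members certified) and becomes `_holds` links; what the line
adds over every prior treatment is (i) the exact rank-0 constant term on ALL of X3♯(G-ord) with the
local tower kernel proved trivial (`GoodModelLine.ClassX3Gord.localTowerKerPrimary_zero_eq_bot`, no
non-anomalous hypothesis), (ii) the honest isolation of what remains: Skinner–Urban-type Eisenstein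
congruences for f_V ⊗ ω^{(p−1)/2} (SkinnerUrban2014 Thm 3.6.4 excludes this tame character), the
rank-1 branch p-adic Gross–Zagier (Disegni2017 Thm B / Kobayashi2013 shapes vs Delbourgo's height),
the (M)-measure, and the defect-3,4,6 corner where no elliptic-curve measure exists (Delbourgo1998
p. 150). Areas imported: Iwasawa theory of modular forms over ℚ(μ_{p^∞}) (Eisenstein ideal on
U(2,2)), p-adic heights / Gross–Zagier, Galois deformation of reducible residual representations.
Negatives index: no refuted statement of the summit concerns additive primes (checked `ledger
negatives`).

RANKED CRUXES. #2 GordTwoRankZeroOffCaseOne (crux) — For every E/ℚ (globally minimal W) of analytic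
rank 0 and every odd additive prime p of type (G)-ordinary with semistability index 2 (Kodaira I₀*)
such that NO globally minimal curve isogenous to E lies on X3♯(G-ord) with index 2 and a Case-1 line
datum (all irreducible rows, and the reducible rows whose twist V has V[p]^ss containing an even
unramified character), ord_p #Ш(E)_an ≤ ord_p #Ш(E): the main-conjecture lower bound for f_V ⊗
ω^{(p−1)/2} at T = 0. [difficulty: open-problem] (why it might fail: True as a statement iff BSD; as
a LINE it fails if Eisenstein congruences for f⊗ω^{(p−1)/2} cannot be produced: SU 2014 Thm 3.6.4
needs the tame character trivial, Wan 2015 needs p unramified, BSTW 2024 is announced only; on the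
no-Case-1 reducible rows μ(V) > 0 occurs (11a1 at 5).) [SkinnerUrban2014, Delbourgo1998, Wan2015,
FouquetWan2021, Fouquet2024CongruencesIMC, EmertonPollackWeston2006, BurungaleSkinnerTianWan2024,
GreenbergLNM1716]
#3 GordTwoRankOne (crux) — For every E/ℚ of analytic rank 1 and every odd additive (G)-ordinary
prime p of semistability index 2, ord_p #Ш(E)_an ≤ ord_p #Ш(E) (row B6 on I₀*): the Λ-adic lower
bound on the branch (`ChiBranchLowerDivisibilityAt`) composed with a rank-1 p-adic Gross–Zagier
formula on the branch (`BranchPAdicGrossZagier[Odd]At`, rank 0 proved) and Schneider's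
non-degeneracy; on the reducible Case-1 rows gz's end state
`ClassX3Gord.bsdp_rankOne_of_facts_of_delbourgoDatumFact_of_branchCoeffOneNeZero` (p403164) reduces
it to the per-pair first branch coefficient A′ ≠ 0. [difficulty: open-problem] (why it might fail:
No p-adic GZ is in print on the cyclotomic ω^{(p−1)/2}-branch; Disegni 2017 Thm B covers
pot-ordinary v ∣ p (p split in K, χ non-exc) but its L-function/Nekovář height are not identified
with Delbourgo's branch measure/height at additive p (GZ-H); A′ = 0 pairs void the reducible road.)
[Delbourgo2002, Disegni2017, Kobayashi2013, MazurTateTeitelbaum1986Invent, Pal2012]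
#4 MultLower (crux) — For every E/ℚ of analytic rank ≤ 1 and every odd additive prime p at which E
is potentially multiplicative (cell (M): E = V ⊗ χ_{p*}, V multiplicative at p), ord_p #Ш(E)_an ≤
ord_p #Ш(E): the `⊆ (𝓛)` direction of Delbourgo's (M)-measure main conjecture at T = 0 (rank 0) and
its derivative form with the one-term mult-branch p-adic Gross–Zagier `BranchPAdicGrossZagierMultAt`
(rank 1; rank-0 case a theorem, no period fact). [difficulty: open-problem] (why it might fail: The
multiplicative-at-p IMC ⊆(𝓛) is printed only on the TRIVIAL branch (Skinner 2016 Thm A/C, p ‖ N; SU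
2014 Cor 3.6.2/3.6.3: level Np^r with χ = ω^{k−2}·(p-power order) only); on the ω^{(p−1)/2}-branch
the exceptional-zero interaction at T = 0 is untreated; at p = 3 image hypotheses fail.)
[Delbourgo1998, Skinner2016PacificMC, SkinnerUrban2014, Kato2004Asterisque, GreenbergStevens1993]
#5 GordHigherLower (crux) — (declared RESIDUAL) For every E/ℚ of analytic rank ≤ 1 and every odd
additive (G)-ordinary prime p of semistability index e ∈ {3,4,6} (p ≥ 5 forced), ord_p #Ш(E)_an ≤
ord_p #Ш(E): the `CycLeadingTermAt` corner, where E acquires good ordinary reduction only over a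
cyclic extension of degree e and Delbourgo's improved L-function is a piece of the Jacobian of
X₁(Np), not an elliptic-curve measure. [difficulty: open-problem] (why it might fail: No p-adic
L-function interpolating L(E,χ,1) with the right periods is constructed for e ∈ {3,4,6} (Delbourgo
1998 p. 150: the branch object is a piece of Jac X₁(147)); even the UPPER half is a theorem there
only on X4 ∧ surj.) [Delbourgo1998, Kato2004Asterisque]
#6 ReadingFacts (crux) — The READING inputs of the cell's end states — the four displayed binders
that referee A (pub-bsdpct round 244) flags as a reading of a printed theorem at an ADDITIVE
potentially ordinary prime rather than its verbatim statement — as one conjunction of the tree's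
named facts: Wuthrich 2014 Thm 16 (half the χ-eigen characteristic ideal divides the cyclotomic
prime; printed with p semistable for E), Greenberg–Vatsal 2000 Thm (3.12) (unit content and λ of the
ω^{(p−1)/2}-branch read off the residual representation; printed for p ∤ N, good ordinary),
Greenberg–Vatsal 2000 p. 28 / p. 30 residual liftings with a prescribed even (ramified) line
(printed for good ordinary p ≥ 5), Delbourgo 1998 Prop 4 in the exact unit form at a potentially
good ordinary p (printed as a p-power divisibility). Each conjunct is a typed Literature Prop with
its cite tag; the item closes by formalisation of the four readings (or is refuted by one
counter-example to a conjunct as typed), and every one of the cell's 824 booked rank-0 rows is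
literal-by-name modulo exactly these. [difficulty: L] (why it might fail: a conjunct may be
misstated at additive p — e.g. GV (3.12) needs μ(E[p]-branch) = 0 input that p ∤ N supplies via
Kato/Ferrero–Washington, and Thm 16's semistability enters through the Néron component group at p.)
[Wuthrich2014, GreenbergVatsal2000, Delbourgo1998, Kato2004Asterisque]
#9 PrintedFacts (support) — The inputs of the cell's end states that are VERBATIM IN PRINT, as one
conjunction of the tree's named facts: Greenberg–Vatsal 2000 Cor (2.3)/Prop (2.4) (non-primitive
Selmer invariants at the datum), Greenberg LNM 1716 Prop 4.14 (no finite Λ-submodule) and Props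
2.2/2.4 (Kummer image), Delbourgo 1998 Prop 4 (weak p-power form), Gross–Zagier–Kolyvagin (rank =
r_an ≤ 1, Ш finite), modularity (entire L-function), existence of a modular parametrisation,
Cassels' isogeny invariance of the BSD quotient. Published theorems, unformalised (referee A: PRE
facts); the item closes only by formalisation. [difficulty: open-problem] [GreenbergVatsal2000,
GreenbergLNM1716, Delbourgo1998, Kato2004Asterisque, MilneADT2006]
#9 X3CaseOneRankZero (support) — From the printed and the reading inputs: for every E/ℚ of analytic
rank 0 and every odd additive (G)-ordinary prime p of semistability index 2 such that some globally
minimal curve E′ isogenous to E lies on X3♯(G-ord) with index 2 and carries a Case-1 line datum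
(`HasCaseOneMember`), ord_p #Ш(E)_an ≤ ord_p #Ш(E). Provable now: the intrinsic end states
`ClassX3Gord.bsdp_rankZero_of_facts_intrinsic` (p ≥ 5) /
`…bsdp_three_rankZero_of_facts_of_lineDatum_intrinsic` (p = 3) on E′ (analytic rank is an isogeny
invariant, `analyticRank_eq_of_isIsogenous'`), then `N10.missingLowerBoundAt_of_isIsogenous_of_bsdp`
(Cassels). The 824 r0 classes of the member tables are instances (kernel records
`x3LineDatumThree_<label>` at p = 3). [difficulty: provable-now] [GreenbergVatsal2000,
Delbourgo1998, Wuthrich2014, MilneADT2006]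

TWO-LAYER PLAN. GordTwoRankZeroOffCaseOne ⇐ (ChiBranchDivisibilityIrr: ∀ irreducible I₀* rank-0
rows, `ChiBranchLowerDivisibilityAt W p` resp. `ChiBranchLowerLeadingTermOddAt`) →
(NoCaseOneReducibleMu: the reducible no-Case-1 rows via Greenberg's μ-formula) →
GordTwoRankZeroOffCaseOne, glue =
`chiBranchLowerLeadingTermAt_of_divisibility_of_padicValRat_j_nonneg` ∘
`shaOrder_le_of_cycLeadingTerm`. GordTwoRankOne ⇐ (BranchGZRankOne: `BranchPAdicGrossZagierAt W p
Dh` in rank 1) → (ChiBranchDivisibility, shared with the previous split) → GordTwoRankOne, glue =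
`cycLowerBoundAt_of_chiBranchLower_of_branchPAdicGrossZagier` ∘
`cycLowerBoundAt_iff_missingLowerBoundAt`. MultLower ⇐ (MultBranchIMC rank 0) →
(MultBranchGZRankOne) → MultLower. Nothing filed now.

KILL CRITERIA. None of the cruxes can be refuted without refuting BSD itself (each is a restriction
of the rung); the route is retired `exhausted` if the tribunal grades GordTwoRankZeroOffCaseOne
summit-strength without a separating witness, or `superseded` if a route through an announced
general IMC (BSTW 2024 §9) lands the lower bound on all ordinary twists at once. A refutation of
ReadingFacts or PrintedFacts (a mis-transcribed named fact) forces a restatement of that conjunct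
only.

NOT DECOMPOSED YET. The Λ-adic vs T = 0 split of crux 2 (`ChiBranchLowerDivisibilityAt` vs
`ChiBranchLowerLeadingTermAt`), the p ≡ 1 / 3 (mod 4) split (plus vs minus symbols), the Schneider
non-degeneracy input and the Disegni↔Delbourgo height comparison inside crux 3, the rank split of
crux 4, and the image split (surj / Borel / exotic) everywhere — all layer-2 children once a crux is
claimed.

CHEAPEST FALSIFIER. For the support X3CaseOneRankZero (the only provable-now item): `lean check` of
the composition intrinsic end state ∘ `analyticRank_eq_of_isIsogenous'` ∘
`N10.missingLowerBoundAt_of_isIsogenous_of_bsdp` on one kernel-recorded pair (450d2, p = 3: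
`x3LineDatumThree_450d2`) — if the binders do not line up the item is mis-typed. For crux 2: the
pair (11a1 ⊗ χ_5 = 275b?, p = 5) has no Case-1 member and μ-invariant questions; BSD(E,5) there is
decided by 5-descent (LMFDB) — a numerical contradiction would kill the statement (none expected).

NUMBERS. Census of record (TARGET.md §2, b2b RESIDUAL-MAP): B2 = X4 r0 759 + X3 r0 3 737 book230
cells; B6 = X3 r1 15 301 + X4 r1 8 602; (M) r0 92 417 S-b pairs, r1 7 816; (G-ord, e = 2) X4 3 179 +
X3 230 (+ Gord3 2 987); (G-ord, e ∈ {3,4,6}) 425 r1 pairs, X4 r0 3 710 + X3 363. Reached by name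
(support X3CaseOneRankZero instances): 599 r0 classes booked (454 close outright), 225 anomalous r0
classes pending the intrinsic end states, 80 r1 classes pending gz's A′ table.

DEFINITION REQUESTS. None: `CaseOneDatum` / `HasCaseOneMember` are filed as tree definitions
(`Additive/X3CaseOneMember.lean`) together with the leaf.

Novelty: Searches (2026-08-25): lit search "main conjecture quadratic twist additive reduction ordinary"
(corpus); lit search --hybrid "Skinner Urban main conjecture tame character omega branch"; lit
galaxy search "potentially good ordinary|additive reduction main conjecture" --star all; lean search
'LowerHalf' / 'CellGordTwo' (tree: N10/O7 statements, no route); ledger negatives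
BirchSwinnertonDyer (no additive-prime entry).
Nearest prior art found: Delbourgo1998 (Compositio 113) states the Main Conjecture on (G)/(M) and
proves the algebraic side; SkinnerUrban2014 Thm 3.6.4 proves three-variable main conjectures
excluding the tame character needed here; BurungaleSkinnerTianWan2024 (arXiv:2409.01350, announced)
claims IMCs for quadratic twists under hypotheses not covering additive p; Fouquet2024CongruencesIMC
(Publ. math. Besançon 2024, doi:10.5802/pmb.54, PUBLISHED; cell dossier
lit/fouquet2024/STATEMENTS.md) proves μ-free propagation of the cyclotomic IMC along a
Hida/eigenvariety fibre under big residual image — no base case on the ω^{(p−1)/2}-branch of an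
additive twist is in print (lit sheet lit/ROUTE-K1-PRIOR-ART.md §1–§2, EISBR-STARTER rows 1–9:
corpus fts+vec, arXiv/crossref, galaxy all-stars, 2026-08-21 and 2026-08-25); in the tree, routes
LeadingTerm / PAdicOrder attack the summit's leading term at GOOD primes only.
Delta: first route that makes the additive potentially-ordinary p-part a ledger object: the
reducible I₀* rows closed from published facts with the local tower  [refs: 10.5802/pmb.54, 2409.01350, doi:10.5802/pmb.54, Delbourgo1998, SkinnerUrban2014, BurungaleSkinnerTianWan2024]

Barriers (technique_class: iwasawa-main-conjecture, twist-transport, padic-gross-zagier): - technique_class: iwasawa-main-conjecture, twist-transport, padic-gross-zagier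
- Literature.Barriers.BirchSwinnertonDyer.PAdicHeightBarrier: INSIDE for the rank-1 rows of
GordTwoRankOne / MultLower / GordHigherLower if the proof is cyclotomic (`ord_{T=0} L_p(V) = 1`
needs p-adic height non-degeneracy = Schneider's conjecture, whose only theorem is Schneider 1985
for a character generator): the line carries the height hypothesis as an explicit per-pair input
(certified numerically per pair by the predecessor cell, never class-wide) — it does not beat the
barrier class-wide; the bet is that rank-1 rows are booked per pair, or via the anticyclotomic
DEFINITE main conjecture where no cyclotomic height enters; OUTSIDE for the rank-0 cruxes
GordTwoRankZeroOffCaseOne / X3CaseOneRankZero (no height, `L_p(V,0) ≠ 0` read off the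
interpolation).
- Literature.Barriers.BirchSwinnertonDyer.ExceptionalZeroBarrier: INSIDE only for MultLower (V = E ⊗
χ multiplicative at p; the split case has the MTT trivial zero) — discharged in print by the
Greenberg–Stevens 𝓛-invariant formula and Delbourgo 1998's improved (M)-measure
[corpus:GreenbergStevens1993], [corpus:Delbourgo1998 Thm 3 / Prop 4]; outside for
GordTwoRankZeroOffCaseOne / GordTwoRankOne / GordHigherLower (twist good ordinary resp. potentially
good: unit root ≠ 1, no trivial zero).
- Literature.Barriers.BirchSwinnertonDyer.ExceptionalZeroBarrierNarrow: the narrow form blocks only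
identities using the Mazur–Tate–Teitelbaum `L_p(E,T)` at

History (route lifecycle, newest last):
- 2026-08-26T08:36:06Z · rev 9: dropped stmt-BirchSwinnertonDyer-19504, stmt-BirchSwinnertonDyer-19505, stmt-BirchSwinnertonDyer-19508, stmt-BirchSwinnertonDyer-19509, stmt-BirchSwinnertonDyer-19510, stmt-BirchSwinnertonDyer-19511, stmt-Bir — undo the 08:11Z split family of MultLower (19359) born minutes ago, unclaimed, so it can be re-filed w (planner-bsd-addord-plan-g15-0)
- 2026-08-27T22:18:50Z · rev 13: dropped SelfTwistJSWIndexBound — drop item 23009 SelfTwistJSWIndexBound (support r9, filed 22:00Z by me): MISSTATED at p = 3 — unit term 2·v_p(w_K) missing (bsd-addord k1-c3x g5 STATUS l.1900: (planner-bsd-addord-plan-g25-0)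

sub-problem: BirchSwinnertonDyer · status: open · opened planner-bsd-addord-plan-g10-0 2026-08-25T21:34:57Z · rev 14 · ledger route-BirchSwinnertonDyer-AdditiveBranchIMC
GENERATED by the gate from the ledger (D-0016/17). Provers cite these decls: `theorem foo : Summit.BirchSwinnertonDyer.BirchSwinnertonDyer.Theses.AdditiveBranchIMC.<Decl> := …` in Summits/BirchSwinnertonDyer/BirchSwinnertonDyer/Theorems/<Name>.lean.
-/

namespace Summit.BirchSwinnertonDyer.BirchSwinnertonDyer.Theses.AdditiveBranchIMC

open scoped BigOperators Topology Manifold Classical MeasureTheory ProbabilityTheory Matrix InnerProductSpace ComplexConjugate ContinuousMap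
open Filter Set Function TopologicalSpace MeasureTheory

attribute [summit_statement] _root_.BirchSwinnertonDyer
attribute [summit_statement] _root_.Summit.BirchSwinnertonDyer.Rank1Residual.Additive.AdditiveOrdinaryLowerHalf

open Literature

/-- item stmt-BirchSwinnertonDyer-19357 · crux · rank 2 · SPLIT (gen 1) into GordTwoRankZeroOffCaseOneEven, GordTwoRankZeroOffCaseOneOdd + glue GordTwoRankZeroOffCaseOneGlue · direct attempts still welcome (low priority) · by planner
why it might fail: True as a statement iff BSD; as a LINE it fails if Eisenstein congruences for f⊗ω^{(p−1)/2} cannot be produced: SU 2014 Thm 3.6.4 needs the tame character trivial, Wan 2015 needs p unramified, BSTW 2024 is announced only; on the no-Case-1 reducible rows μ(V) > 0 occurs (11a1 at 5).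
sources: SkinnerUrban2014, Delbourgo1998, Wan2015, FouquetWan2021, Fouquet2024CongruencesIMC, EmertonPollackWeston2006
[crux] For every E/ℚ (globally minimal W) of analytic rank 0 and every odd additive prime p of type
(G)-ordinary with semistability index 2 (Kodaira I₀*) such that NO globally minimal curve isogenous
to E lies on X3♯(G-ord) with index 2 and a Case-1 line datum (all irreducible rows, and the
reducible rows whose twist V has V[p]^ss containing an even unramified character), ord_p #Ш(E)_an ≤
ord_p #Ш(E): the main-conjecture lower bound for f_V ⊗ ω^{(p−1)/2} at T = 0. [difficulty:
open-problem] -/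
@[route_item "route-BirchSwinnertonDyer-AdditiveBranchIMC", crux]
def GordTwoRankZeroOffCaseOne : Prop :=
  ∀ (W : WeierstrassCurve ℚ) [W.IsElliptic] [W.IsGloballyMinimal] (p : ℕ) [Fact p.Prime], W.analyticRank = 0 → Summit.BirchSwinnertonDyer.Rank1Residual.Additive.N10.CellGordTwo W p → ¬ Summit.BirchSwinnertonDyer.Rank1Residual.Additive.HasCaseOneMember W p → Literature.NumberTheory.EllipticCurves.Rank1Residual.Typed.MissingLowerBoundAt W p

-- parent: GordTwoRankZeroOffCaseOne · child (gen 1)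
/--     item stmt-BirchSwinnertonDyer-19244 · crux · rank 201 · open
    parent: GordTwoRankZeroOffCaseOne · by planner
    why it might fail: The ⊆(𝓛) direction on the ramified tame branch ω^{(p−1)/2} of f_{E♭} is in print nowhere (SU14 Thm 3.6.4: trivial tame branch only; Wan15: p unramified; BSTW24 9.21(c) announced, p ≥ 5, Irr, Ram only); reducible off-Case-1 rows are μ-territory (11a1-type μ > 0 at 5).
    sources: SkinnerUrban2014, Pal2012, BurungaleSkinnerTianWan2024, Delbourgo1998, MazurTateTeitelbaum1986Invent
[crux] EVEN-BRANCH half of 19357 (p ≡ 1 mod 4, the ω^{(p−1)/2}-branch is even: plus modular symbols,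
period step by Pal 2012 Thm 3.2): for every E/ℚ (globally minimal W) of analytic rank 0 and every
additive (G)-ordinary prime p ≡ 1 (mod 4) of semistability index 2 off Case 1, ord_p #Ш(E)_an ≤
ord_p #Ш(E). Its one layer-2 input (k1-c2 p418190 §2
`missingLowerBoundAt_cellGordTwo_rankZero_of_chiBranchLowerDivisibility`, kernel-checked modulo
hDelG hPal hGZK hmod hmodD) is the Λ-adic lower divisibility `ChiBranchLowerDivisibilityAt W p` =
char_Λ X(E♭ ⊗ ω^{(p−1)/2}-branch) ⊆ (L_p^{br,+}) on these rows — the Skinner–Urban direction on a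
NON-trivial tame branch. -/
@[route_item "route-BirchSwinnertonDyer-AdditiveBranchIMC"]
def GordTwoRankZeroOffCaseOneEven : Prop :=
  ∀ (W : WeierstrassCurve ℚ) [W.IsElliptic] [W.IsGloballyMinimal] (p : ℕ) [Fact p.Prime], W.analyticRank = 0 → Summit.BirchSwinnertonDyer.Rank1Residual.Additive.N10.CellGordTwo W p → ¬ Summit.BirchSwinnertonDyer.Rank1Residual.Additive.HasCaseOneMember W p → p % 4 = 1 → Literature.NumberTheory.EllipticCurves.Rank1Residual.Typed.MissingLowerBoundAt W p

-- parent: GordTwoRankZeroOffCaseOne · child (gen 1)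
/--     item stmt-BirchSwinnertonDyer-19245 · crux · rank 202 · open
    parent: GordTwoRankZeroOffCaseOne · by planner
    why it might fail: Same gap as the even half (no printed ⊆(𝓛) on the ramified tame branch) plus p = 3: image/level hypotheses of every Eisenstein-congruence engine fail at 3, and the odd-symbol Manin/period bookkeeping has no Pal-type theorem (GV (3.6) covers admissible signs only).
    sources: SkinnerUrban2014, GreenbergVatsal2000, FouquetWan2021, Delbourgo1998, Kim2025arXiv250509121
[crux] ODD-BRANCH half of 19357 (p ≡ 3 mod 4, the ω^{(p−1)/2}-branch is odd: minus modular symbols,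
imaginary period; no Pal input, GV Lemma (3.6) admissible-sign period step): for every E/ℚ (globally
minimal W) of analytic rank 0 and every additive (G)-ordinary prime p ≡ 3 (mod 4) of semistability
index 2 off Case 1, ord_p #Ш(E)_an ≤ ord_p #Ш(E). Its one layer-2 input (k1-c2 p418190 §2
`missingLowerBoundAt_cellGordTwo_rankZero_of_chiBranchLowerDivisibilityOdd`, kernel-checked modulo
hDelG hGZK hmod hmodD) is the Λ-adic lower divisibility `ChiBranchLowerDivisibilityOddAt W p` on
these rows; p = 3 rows overlap route W2 (Kim at 3) per pair. -/
@[route_item "route-BirchSwinnertonDyer-AdditiveBranchIMC"]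
def GordTwoRankZeroOffCaseOneOdd : Prop :=
  ∀ (W : WeierstrassCurve ℚ) [W.IsElliptic] [W.IsGloballyMinimal] (p : ℕ) [Fact p.Prime], W.analyticRank = 0 → Summit.BirchSwinnertonDyer.Rank1Residual.Additive.N10.CellGordTwo W p → ¬ Summit.BirchSwinnertonDyer.Rank1Residual.Additive.HasCaseOneMember W p → p % 4 = 3 → Literature.NumberTheory.EllipticCurves.Rank1Residual.Typed.MissingLowerBoundAt W p

-- parent: GordTwoRankZeroOffCaseOne · glue (gen 1)
/--     item stmt-BirchSwinnertonDyer-19246 · support · rank 203 · closed · proved by Summit.BirchSwinnertonDyer.BirchSwinnertonDyer.Theorems.additiveBranchIMC_gordTwoRankZeroOffCaseOneGlue_proof (prover)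
    parent: GordTwoRankZeroOffCaseOne · GLUE: children ⟹ parent · by planner
parity glue: an odd prime is ≡ 1 or ≡ 3 (mod 4) and N10.CellGordTwo W p gives p ≠ 2, so Even → Odd →
GordTwoRankZeroOffCaseOne is six lines of logic — PROVED in the planner sketch
run/sessions/planner-bsd-addord-plan-g13-0/folder/split19357/SketchSplit.lean (theorem
gordTwoRankZeroOffCaseOne_of_even_of_odd, lean check rc 0); a K1 hand lands it verbatim against this
glue item -/
@[route_item "route-BirchSwinnertonDyer-AdditiveBranchIMC"]
def GordTwoRankZeroOffCaseOneGlue : Prop :=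
  GordTwoRankZeroOffCaseOneEven → GordTwoRankZeroOffCaseOneOdd → GordTwoRankZeroOffCaseOne

-- `GordTwoRankZeroOffCaseOneGlue` holds: proved by `Summit.BirchSwinnertonDyer.BirchSwinnertonDyer.Theorems.additiveBranchIMC_gordTwoRankZeroOffCaseOneGlue_proof` (its module imports this route file, so no `_holds` link can be stated here).

/-- item stmt-BirchSwinnertonDyer-19358 · crux · rank 3 · SPLIT (gen 1) into PrintedAndReadingFacts, MazurUniversalNormIndex, DisegniDelbourgoCycLineGrossZagier, DisegniDelbourgoCycLineGrossZagierThree, RankinSelbergBaseChangeDirichlet, GrossZagierRationalPointI73, WaldspurgerHeegnerTwistNonvanishing, DelbourgoLeadingTermMain, DelbourgoLeadingTermMainThree, NewformOfEllipticCurve, LiLiuTianCMRankOne, GordTwoLambdaEven, GordTwoLambdaOdd, GordTwoRankOneClassCert + glue GordTwoRankOneOfParts · direct attempts still welcome (low priority) · by planner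
why it might fail: No p-adic GZ is in print on the cyclotomic ω^{(p−1)/2}-branch; Disegni 2017 Thm B covers pot-ordinary v ∣ p (p split in K, χ non-exc) but its L-function/Nekovář height are not identified with Delbourgo's branch measure/height at additive p (GZ-H); A′ = 0 pairs void the reducible road.
sources: Delbourgo2002, Disegni2017, Kobayashi2013, MazurTateTeitelbaum1986Invent, Pal2012
[crux] For every E/ℚ of analytic rank 1 and every odd additive (G)-ordinary prime p of semistability
index 2, ord_p #Ш(E)_an ≤ ord_p #Ш(E) (row B6 on I₀*): the Λ-adic lower bound on the branch
(`ChiBranchLowerDivisibilityAt`) composed with a rank-1 p-adic Gross–Zagier formula on the branch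
(`BranchPAdicGrossZagier[Odd]At`, rank 0 proved) and Schneider's non-degeneracy; on the reducible
Case-1 rows gz's end state
`ClassX3Gord.bsdp_rankOne_of_facts_of_delbourgoDatumFact_of_branchCoeffOneNeZero` (p403164) reduces
it to the per-pair first branch coefficient A′ ≠ 0. [difficulty: open-problem] -/
@[route_item "route-BirchSwinnertonDyer-AdditiveBranchIMC", crux]
def GordTwoRankOne : Prop :=
  ∀ (W : WeierstrassCurve ℚ) [W.IsElliptic] [W.IsGloballyMinimal] (p : ℕ) [Fact p.Prime], W.analyticRank = 1 → Summit.BirchSwinnertonDyer.Rank1Residual.Additive.N10.CellGordTwo W p → Literature.NumberTheory.EllipticCurves.Rank1Residual.Typed.MissingLowerBoundAt W p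

-- parent: GordTwoRankOne · child (gen 1)
/--     item stmt-BirchSwinnertonDyer-19497 · crux · rank 312 · open
    parent: GordTwoRankOne · by planner
    why it might fail: ω^{(p−1)/2}-branch LOWER containment for the good-ordinary twist model: in print for no weight-2 form (SU 3.6.4 = trivial branch; Kato 17.4, Wuthrich 16 = opposite containment); only as transport (EPW 5.1.4 from a μ = λ = 0 partner; GV 3.12) or PRE (BSTW 9.21c); fails on rows with μ > 0, no partner.
    sources: SkinnerUrban2014, Thm. 3.6.4 and Cor. 3.6.2/3.6.3, Kato2004Asterisque, Thm. 17.4, Wuthrich2014, Thm. 16, EmertonPollackWeston2006, Cor. 5.1.4, GreenbergVatsal2000, (3.12), BurungaleSkinnerTianWan2024, Thm. 9.21 (c) (PRE)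
[crux] Λ-ADIC LOWER CONTAINMENT, EVEN BRANCH (rank-free, off Case 1): for every globally minimal E/ℚ
and every odd additive (G)-ordinary prime p of semistability index 2 (cell `N10.CellGordTwo`) whose
isogeny class has NO Case-1 member, with p ≡ 1 (mod 4) (the ω^{(p−1)/2}-branch is even: plus modular
symbols), `ChiBranchLowerDivisibilityAt W p` — char_Λ of the branch Selmer module of E♭ ⊗
ω^{(p−1)/2} divides / is contained in the branch p-adic L-function ideal (the Skinner–Urban
direction on a NON-trivial ramified tame branch). Binder `hΛ` of p425970
`Theorems.AdditiveBranchIMCGordTwoRankOneSplitGlue.gordTwoRankOne_of_parts`; the SAME statement is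
the layer-2 input of 19244 (rank 0, even) — one conjecture item serves both cruxes (SPLIT-DRAFTS-g14
design (i), director GO 06:32:55Z). [deps: GordTwoRankZeroOffCaseOneEven] [difficulty: open-problem] -/
@[route_item "route-BirchSwinnertonDyer-AdditiveBranchIMC", crux]
def GordTwoLambdaEven : Prop :=
  ∀ (W : WeierstrassCurve ℚ) [W.IsElliptic] [W.IsGloballyMinimal] (p : ℕ) [Fact p.Prime], Summit.BirchSwinnertonDyer.Rank1Residual.Additive.N10.CellGordTwo W p → ¬ Summit.BirchSwinnertonDyer.Rank1Residual.Additive.HasCaseOneMember W p → p % 4 = 1 → Summit.BirchSwinnertonDyer.Rank1Residual.Additive.ChiBranchLowerDivisibilityAt W p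

-- parent: GordTwoRankOne · child (gen 1)
/--     item stmt-BirchSwinnertonDyer-19498 · crux · rank 313 · open
    parent: GordTwoRankOne · by planner
    why it might fail: As the even branch: in print for no form (SU = trivial branch; Kato 17.4 / Wuthrich 16 = opposite containment; EPW Cor 5.1.4 / GV (3.12) = transport only; BSTW, FW21 = PRE); at p = 3 additionally no Hida-family transport is in print (EPW needs p ≥ 5); fails on a row with μ(branch) > 0 or no partner.
    sources: SkinnerUrban2014, Thm. 3.6.4 and Cor. 3.6.2/3.6.3, Kato2004Asterisque, Thm. 17.4, Wuthrich2014, Thm. 16, EmertonPollackWeston2006, Cor. 5.1.4 (p ≥ 5), GreenbergVatsal2000, (3.12), MazurTateTeitelbaum1986Invent, §I.14 (minus symbols)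
[crux] Λ-ADIC LOWER CONTAINMENT, ODD BRANCH (rank-free, off Case 1): the same for p ≡ 3 (mod 4) (the
ω^{(p−1)/2}-branch is odd: minus modular symbols, imaginary period),
`ChiBranchLowerDivisibilityOddAt W p`, on every pair of cell `N10.CellGordTwo` without a Case-1
member; includes p = 3. Binder `hΛ'` of p425970
`Theorems.AdditiveBranchIMCGordTwoRankOneSplitGlue.gordTwoRankOne_of_parts`; also the layer-2 input
of 19245 (rank 0, odd). [deps: GordTwoRankZeroOffCaseOneOdd] [difficulty: open-problem] -/
@[route_item "route-BirchSwinnertonDyer-AdditiveBranchIMC", crux]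
def GordTwoLambdaOdd : Prop :=
  ∀ (W : WeierstrassCurve ℚ) [W.IsElliptic] [W.IsGloballyMinimal] (p : ℕ) [Fact p.Prime], Summit.BirchSwinnertonDyer.Rank1Residual.Additive.N10.CellGordTwo W p → ¬ Summit.BirchSwinnertonDyer.Rank1Residual.Additive.HasCaseOneMember W p → p % 4 = 3 → Summit.BirchSwinnertonDyer.Rank1Residual.Additive.ChiBranchLowerDivisibilityOddAt W p

-- parent: GordTwoRankOne · child (gen 1)
/--     item stmt-BirchSwinnertonDyer-19499 · crux · rank 314 · open
    parent: GordTwoRankOne · by planner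
    why it might fail: A′ (first branch coefficient) could vanish on some non-CM rank-1 pair of the cell — p-adic height degeneracy (Schneider's conjecture) is open; the certificates discharge it class by class numerically (gz5-p3), never uniformly, and say nothing off the computed range.
    sources: Schneider1985, Disegni2017, Thm. B, Delbourgo2002, Theorem (B), MazurTateTeitelbaum1986Invent
[crux] NON-CM RANK-1 CLASS CERTIFICATE: for every globally minimal E/ℚ of analytic rank 1 WITHOUT CM
and every odd additive (G)-ordinary p of semistability index 2, the first branch coefficient A′ of
the branch p-adic L-function is non-zero (`BranchCoeffOneNeZeroAt W p`; Schneider non-degeneracy in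
certificate form). Binder `hCert` of p425970
`Theorems.AdditiveBranchIMCGordTwoRankOneSplitGlue.gordTwoRankOne_of_parts` (the class-read variant
`gordTwoRankOne_of_parts_classCert` shows one number per isogeny class suffices,
`N10.cellGordTwo_of_isIsogenous`). Numerically discharged per class by gz's two-engine certificates
(proof/gz5-p3 MANIFEST) on the covered rows; as a ∀-statement it is Schneider's conjecture on this
cell. [difficulty: open-problem] -/
@[route_item "route-BirchSwinnertonDyer-AdditiveBranchIMC"]
def GordTwoRankOneClassCert : Prop :=
  ∀ (W : WeierstrassCurve ℚ) [W.IsElliptic] [W.IsGloballyMinimal] (p : ℕ) [Fact p.Prime], W.analyticRank = 1 → Summit.BirchSwinnertonDyer.Rank1Residual.Additive.N10.CellGordTwo W p → ¬ W.HasCM → Summit.BirchSwinnertonDyer.Rank1Residual.Additive.BranchCoeffOneNeZeroAt W p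

-- parent: GordTwoRankOne · child (gen 1)
/--     item stmt-BirchSwinnertonDyer-19478 · support · rank 301 · open
    parent: GordTwoRankOne · by planner
[support] ALIAS (HELD at birth, never staffed): the route's OWN support items `PrintedFacts`
(stmt-BirchSwinnertonDyer-19362, 8 conjuncts) ∧ `ReadingFacts` (stmt-…-19361, 5 conjuncts) restated
verbatim as ONE conjunction — binders `hP`, `hR` of p425970
`Theorems.AdditiveBranchIMCGordTwoRankOneSplitGlue.gordTwoRankOne_of_parts`. A split child is
rendered directly under its parent, ABOVE the decls `ReadingFacts`/`PrintedFacts`, so it cannot name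
them (no forward reference), and a child equal to either signature would be a second alias item
(gate5 via director-bsd 2026-08-26T06:46:54Z); hence the pair. Closes by `⟨PrintedFactsOfParts …,
ReadingFactsOfParts …⟩` the day its 13 leaves do; zero proof weight. [deps: PrintedFacts,
ReadingFacts] [difficulty: cite-only] -/
@[route_item "route-BirchSwinnertonDyer-AdditiveBranchIMC", crux]
def PrintedAndReadingFacts : Prop :=
  (Literature.NumberTheory.EllipticCurves.GreenbergVatsal2000.datumSelmer_nonPrimitive_invariants ∧ Literature.NumberTheory.EllipticCurves.Greenberg1999.prop414_noFiniteSubmodule_of_not_dvd_torsionOrder ∧ Literature.NumberTheory.EllipticCurves.Greenberg1999.imKummer_ge_strictCondition_goodOrdinary ∧ Literature.NumberTheory.EllipticCurves.Delbourgo1998.prop4_rankZero_pow_dvd_constantCoeff ∧ Literature.NumberTheory.EllipticCurves.rank_eq_analyticRank_of_analyticRank_le_one ∧ WeierstrassCurve.hasEntireLFunction_rat ∧ Literature.NumberTheory.EllipticCurves.ModularForms.nonempty_modularParametrizationData ∧ WeierstrassCurve.bsdRHS_eq_of_isIsogenous) ∧ (Literature.NumberTheory.EllipticCurves.Wuthrich2014.thm16_halfEigenCharIdeal_dvd_cyclotomicPrime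 ∧ Literature.NumberTheory.EllipticCurves.GreenbergVatsal2000.thm312_branch_unitContent_and_lambda_eq_residual_goodOrd ∧ Literature.NumberTheory.EllipticCurves.GreenbergVatsal2000.residualEpsilon_surjOn_of_lineRamifiedEven ∧ Literature.NumberTheory.EllipticCurves.GreenbergVatsal2000.residualEpsilon_surjOn_of_lineEven ∧ Literature.NumberTheory.EllipticCurves.Delbourgo1998.prop4_rankZero_constantCoeff_eq_unit_mul_of_potGoodOrd)

-- parent: GordTwoRankOne · child (gen 1)
/--     item stmt-BirchSwinnertonDyer-19479 · support · rank 302 · open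
    parent: GordTwoRankOne · by planner
[support] ALIAS LEAF (cite_only, HELD at birth, never staffed): Mazur 1972 Cor. 5.15 — the
universal-norm index at a good ordinary prime (control of the cyclotomic Selmer corank) BY NAME —
binder `hMaz` of p425970
`Theorems.AdditiveBranchIMCGordTwoRankOneSplitGlue.gordTwoRankOne_of_parts`; the published input
enters the glue item `GordTwoRankOneOfParts` (and so `closes`) as a hypothesis; zero proof weight.
[cite: Mazur1972Towers, Cor. 5.15] [difficulty: cite-only] -/
@[route_item "route-BirchSwinnertonDyer-AdditiveBranchIMC"]
def MazurUniversalNormIndex : Prop :=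
  Literature.NumberTheory.EllipticCurves.Mazur1972.cor515_universalNormIndex

-- parent: GordTwoRankOne · child (gen 1)
/--     item stmt-BirchSwinnertonDyer-19480 · support · rank 303 · open
    parent: GordTwoRankOne · by planner
[support] ALIAS LEAF (cite_only, HELD at birth, never staffed): the cyclotomic-line p-adic
Gross–Zagier formula for the Delbourgo datum at an additive potentially ordinary p ≥ 5 (Disegni 2017
Thm B specialised; the GZ-H identification is part of the named fact) BY NAME — binder `hCyc` of
p425970 `Theorems.AdditiveBranchIMCGordTwoRankOneSplitGlue.gordTwoRankOne_of_parts`; the published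
input enters the glue item `GordTwoRankOneOfParts` (and so `closes`) as a hypothesis; zero proof
weight. [cite: Disegni2017, Thm. B] [difficulty: cite-only] -/
@[route_item "route-BirchSwinnertonDyer-AdditiveBranchIMC"]
def DisegniDelbourgoCycLineGrossZagier : Prop :=
  Literature.NumberTheory.EllipticCurves.Disegni2017.delbourgoDatum_cycLineGrossZagier

-- parent: GordTwoRankOne · child (gen 1)
/--     item stmt-BirchSwinnertonDyer-19481 · support · rank 304 · open
    parent: GordTwoRankOne · by planner
[support] ALIAS LEAF (cite_only, HELD at birth, never staffed): the same cyclotomic-line p-adic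
Gross–Zagier fact at p = 3 (intrinsic form) BY NAME — binder `hCyc3` of p425970
`Theorems.AdditiveBranchIMCGordTwoRankOneSplitGlue.gordTwoRankOne_of_parts`; the published input
enters the glue item `GordTwoRankOneOfParts` (and so `closes`) as a hypothesis; zero proof weight.
[cite: Disegni2017, Thm. B (p = 3 intrinsic)] [difficulty: cite-only] -/
@[route_item "route-BirchSwinnertonDyer-AdditiveBranchIMC"]
def DisegniDelbourgoCycLineGrossZagierThree : Prop :=
  Literature.NumberTheory.EllipticCurves.Disegni2017.delbourgoDatum_cycLineGrossZagier_intrinsicThree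

-- parent: GordTwoRankOne · child (gen 1)
/--     item stmt-BirchSwinnertonDyer-19491 · support · rank 305 · closed · proved by Summit.BirchSwinnertonDyer.BirchSwinnertonDyer.Theorems.AdditiveBranchIMCRankinSelbergBaseChangeDirichlet.rankinSelbergBaseChangeDirichlet_proof (prover)
    parent: GordTwoRankOne · by planner
[support] ALIAS LEAF (cite_only, HELD at birth, never staffed): Artin formalism: the Rankin–Selberg
Euler product of f × θ_χ equals the base-change-twisted Dirichlet series (L(E/K,χ,s) factorisation)
BY NAME — binder `hArt` of p425970
`Theorems.AdditiveBranchIMCGordTwoRankOneSplitGlue.gordTwoRankOne_of_parts`; the published input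
enters the glue item `GordTwoRankOneOfParts` (and so `closes`) as a hypothesis; zero proof weight.
[cite: GrossZagier1986, §IV (Rankin–Selberg); Miller2011LMS, Def. 1.1] [difficulty: cite-only] -/
@[route_item "route-BirchSwinnertonDyer-AdditiveBranchIMC"]
def RankinSelbergBaseChangeDirichlet : Prop :=
  Literature.NumberTheory.EllipticCurves.rankinSelbergEulerProductHecke_baseChangeDirichlet_eq

-- `RankinSelbergBaseChangeDirichlet` holds: proved by `Summit.BirchSwinnertonDyer.BirchSwinnertonDyer.Theorems.AdditiveBranchIMCRankinSelbergBaseChangeDirichlet.rankinSelbergBaseChangeDirichlet_proof` (its module imports this route file, so no `_holds` link can be stated here).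

-- parent: GordTwoRankOne · child (gen 1)
/--     item stmt-BirchSwinnertonDyer-19369 · support · rank 306 · open
    parent: GordTwoRankOne · by planner
[aside] Gross–Zagier 1986 Thm. I.(7.3) (p. 231; proof V.§2 pp. 310–313): L′(E,1) ≠ 0 ⇒ a rational
point of infinite order (via a Heegner point and the GZ formula) — a cite_only dep of this route
reached through the depth-1 support item PublishedInputsIMCReduction
(stmt-BirchSwinnertonDyer-19283, child of 19061; a third item layer is forbidden, so it is
item-stated here as a by-name ASIDE: banked context, never staffed, BC6-exempt; gate5 02:15:40Z
«aside also counts»); no crux statement / closes / tribunal change -/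
@[route_item "route-BirchSwinnertonDyer-AdditiveBranchIMC"]
def GrossZagierRationalPointI73 : Prop :=
  Literature.NumberTheory.EllipticCurves.GrossZagier1986_thm_I_7_3

-- parent: GordTwoRankOne · child (gen 1)
/--     item stmt-BirchSwinnertonDyer-19571 · support · rank 307 · open
    parent: GordTwoRankOne · by planner
[aside] Waldspurger 1985 / Bump–Friedberg–Hoffstein 1990 / Murty–Murty: existence of an imaginary
quadratic K satisfying the Heegner hypothesis for N with L(E^K, 1) ≠ 0
(`waldspurger_exists_heegnerField_twist_ne_zero`) — conjunct 9 of PublishedFactsTwo (19231), BY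
NAME. Banked context (D-0019 aside): never staffed, not progress, BC6-exempt; filed ONLY so the
cite_only head constant is item-stated (gate5 #15c one rule; staffable remedy). -/
@[route_item "route-BirchSwinnertonDyer-AdditiveBranchIMC"]
def WaldspurgerHeegnerTwistNonvanishing : Prop :=
  Literature.NumberTheory.EllipticCurves.waldspurger_exists_heegnerField_twist_ne_zero

-- parent: GordTwoRankOne · child (gen 1)
/--     item stmt-BirchSwinnertonDyer-19492 · support · rank 308 · open
    parent: GordTwoRankOne · by planner
[support] ALIAS LEAF (cite_only, HELD at birth, never staffed): Delbourgo 2002 Main Theorem (A)/(B)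
(p ≥ 5): the leading term of the branch p-adic L-function at additive potentially good ordinary p —
#Ш · Tamagawa · torsion · p-adic regulator shape BY NAME — binder `hDel` of p425970
`Theorems.AdditiveBranchIMCGordTwoRankOneSplitGlue.gordTwoRankOne_of_parts`; the published input
enters the glue item `GordTwoRankOneOfParts` (and so `closes`) as a hypothesis; zero proof weight.
[cite: Delbourgo2002, Theorem (A), (B) (p. 40)] [difficulty: cite-only] -/
@[route_item "route-BirchSwinnertonDyer-AdditiveBranchIMC"]
def DelbourgoLeadingTermMain : Prop :=
  Literature.NumberTheory.EllipticCurves.Delbourgo2002.mainTheorem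

-- parent: GordTwoRankOne · child (gen 1)
/--     item stmt-BirchSwinnertonDyer-19496 · support · rank 309 · open
    parent: GordTwoRankOne · by planner
[support] ALIAS LEAF (cite_only, HELD at birth, never staffed): Delbourgo 2002 Main Theorem at p = 3
(the typed p = 3 variant) BY NAME — binder `hDel3` of p425970
`Theorems.AdditiveBranchIMCGordTwoRankOneSplitGlue.gordTwoRankOne_of_parts`; the published input
enters the glue item `GordTwoRankOneOfParts` (and so `closes`) as a hypothesis; zero proof weight.
[cite: Delbourgo2002, Theorem (A), (B), p = 3] [difficulty: cite-only] -/
@[route_item "route-BirchSwinnertonDyer-AdditiveBranchIMC"]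
def DelbourgoLeadingTermMainThree : Prop :=
  Literature.NumberTheory.EllipticCurves.Delbourgo2002.mainTheorem_three

-- parent: GordTwoRankOne · child (gen 1)
/--     item stmt-BirchSwinnertonDyer-19382 · support · rank 310 · open
    parent: GordTwoRankOne · by planner
[support] Modularity Theorem, Version L (Diamond–Shurman 2005 Thm. 8.8.3; Wiles / Taylor–Wiles /
BCDT 2001 Thm. A): every E/ℚ has a weight-2 newform f of level N_E with L(f,s) = L(E,s) — conjunct
of PublishedInputsFive (stmt-BirchSwinnertonDyer-19066), BY NAME; same content, filed as a split
child so the head constant is item-stated (gate5 #15c one rule / readiness rule 2026-08-15: a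
cite_only dep must be declared by the route); no crux statement / closes / tribunal / tribunal_fit
change -/
@[route_item "route-BirchSwinnertonDyer-AdditiveBranchIMC"]
def NewformOfEllipticCurve : Prop :=
  Literature.NumberTheory.EllipticCurves.ModularForms.exists_isNewformOf

-- parent: GordTwoRankOne · child (gen 1)
/--     item stmt-BirchSwinnertonDyer-19569 · support · rank 311 · open
    parent: GordTwoRankOne · by planner
[aside] Li–Liu–Tian 2024 Thm 1.1: the p-part of BSD for CM E/ℚ of analytic rank 1 at the primes it
covers (`LiLiuTian2024.thm11_bsdp_of_cm_rank_one`; used by the consumer only for r_an = 1 ⇒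
finiteness bookkeeping) — conjunct 4 of PublishedFactsTwo (19231), BY NAME. Banked context (D-0019
aside): never staffed, not progress, BC6-exempt; filed ONLY so the cite_only head constant is
item-stated (gate5 #15c one rule; staffable remedy). -/
@[route_item "route-BirchSwinnertonDyer-AdditiveBranchIMC"]
def LiLiuTianCMRankOne : Prop :=
  Literature.NumberTheory.EllipticCurves.LiLiuTian2024.thm11_bsdp_of_cm_rank_one

-- parent: GordTwoRankOne · glue (gen 1)
/--     item stmt-BirchSwinnertonDyer-19500 · support · rank 315 · closed · proved by Summit.BirchSwinnertonDyer.BirchSwinnertonDyer.Theorems.AdditiveBranchIMCGordTwoRankOne.gordTwoRankOneOfParts_proof (prover)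
    parent: GordTwoRankOne · GLUE: children ⟹ parent · by planner
spec (b′) seam, ALREADY KERNEL-CHECKED: the children are the 15 binders of k1-c3's landed
`Theorems.AdditiveBranchIMCGordTwoRankOneSplitGlue.gordTwoRankOne_of_parts` (p425970), with
`PrintedFacts`/`ReadingFacts` paired into the ONE alias child `PrintedAndReadingFacts` (a split
child renders above those route decls and cannot name them; director-bsd
2026-08-26T06:32:55Z/06:46:54Z): 11 HELD by-name published inputs → the Λ-adic lower containment on
the even / odd ω^{(p−1)/2}-branch off Case 1 (rank-free; shared layer-2 inputs of 19244/19245) → the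
non-CM rank-1 class certificate A′ ≠ 0 ⟹ GordTwoRankOne. A K1 hand closes this glue item with the
3-line wrapper `fun h1 … h14 => gordTwoRankOne_of_parts h1.1 h1.2 h2 … h14` in a Theorems file
importing the SplitGlue module (planner sketch
run/sessions/planner-bsd-addord-plan-g15-0/folder/splits/Sketch19358.lean; `--glue-by` is unusable
because that module imports the route file). -/
@[route_item "route-BirchSwinnertonDyer-AdditiveBranchIMC"]
def GordTwoRankOneOfParts : Prop :=
  PrintedAndReadingFacts → MazurUniversalNormIndex → DisegniDelbourgoCycLineGrossZagier → DisegniDelbourgoCycLineGrossZagierThree → RankinSelbergBaseChangeDirichlet → GrossZagierRationalPointI73 → WaldspurgerHeegnerTwistNonvanishing → DelbourgoLeadingTermMain → DelbourgoLeadingTermMainThree → NewformOfEllipticCurve → LiLiuTianCMRankOne → GordTwoLambdaEven → GordTwoLambdaOdd → GordTwoRankOneClassCert → GordTwoRankOne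

-- `GordTwoRankOneOfParts` holds: proved by `Summit.BirchSwinnertonDyer.BirchSwinnertonDyer.Theorems.AdditiveBranchIMCGordTwoRankOne.gordTwoRankOneOfParts_proof` (its module imports this route file, so no `_holds` link can be stated here).

/-- item stmt-BirchSwinnertonDyer-19359 · crux · rank 4 · SPLIT (gen 2) into DelbourgoPotMultUnit, PalQuadraticTwistPeriod, DelbourgoLeadingTermPotMult, MultModularityInputs, MultLambdaLower, MultSchneiderNondegeneracy, MultBranchPAdicGrossZagierAt + glue MultLowerOfParts · direct attempts still welcome (low priority) · by planner
why it might fail: The multiplicative-at-p IMC ⊆(𝓛) is printed only on the TRIVIAL branch (Skinner 2016 Thm A/C, p ‖ N; SU 2014 Cor 3.6.2/3.6.3: level Np^r with χ = ω^{k−2}·(p-power order) only); on the ω^{(p−1)/2}-branch the exceptional-zero interaction at T = 0 is untreated; at p = 3 image hypotheses fail.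
sources: Delbourgo1998, Skinner2016PacificMC, SkinnerUrban2014, Kato2004Asterisque, GreenbergStevens1993
earlier split gen 1: DelbourgoPotMultUnit, PalQuadraticTwistPeriod, DelbourgoLeadingTermPotMult, MultModularityInputs, MultLambdaLower, MultBranchPAdicGrossZagier — retired -
[crux] For every E/ℚ of analytic rank ≤ 1 and every odd additive prime p at which E is potentially
multiplicative (cell (M): E = V ⊗ χ_{p*}, V multiplicative at p), ord_p #Ш(E)_an ≤ ord_p #Ш(E): the
`⊆ (𝓛)` direction of Delbourgo's (M)-measure main conjecture at T = 0 (rank 0) and its derivative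
form with the one-term mult-branch p-adic Gross–Zagier `BranchPAdicGrossZagierMultAt` (rank 1;
rank-0 case a theorem, no period fact). [difficulty: open-problem] -/
@[route_item "route-BirchSwinnertonDyer-AdditiveBranchIMC", crux]
def MultLower : Prop :=
  ∀ (W : WeierstrassCurve ℚ) [W.IsElliptic] [W.IsGloballyMinimal] (p : ℕ) [Fact p.Prime], W.analyticRank ≤ 1 → Summit.BirchSwinnertonDyer.Rank1Residual.Additive.N10.CellM W p → Literature.NumberTheory.EllipticCurves.Rank1Residual.Typed.MissingLowerBoundAt W p

-- parent: MultLower · child (gen 2)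
/--     item stmt-BirchSwinnertonDyer-19590 · crux · rank 405 · open
    parent: MultLower · by operator
    why it might fail: QBLD(V) = LOWER containment on the ω^{(p−1)/2}-branch of the p-multiplicative newform f_V: in print for NO such form (Skinner 2016, SU 3.6.4 = trivial branch; Wuthrich 16, Kato = opposite containment; GV 3.11 twisted needs K unramified at level primes; FW21/Fouquet hyp 2 fails on (M)); fails if μ>0.
    sources: Skinner2016PacificMC, Thm. A/C, SkinnerUrban2014, Thm. 3.6.4, Cor. 3.6.2/3.6.3, Wuthrich2014, Thm. 16, Kato2004Asterisque, Thm. 12.5/17.4, GreenbergVatsal2000, (3.11), FouquetWan2021, hyp. 2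
[crux] Λ-ADIC LOWER CONTAINMENT AT THE MULTIPLICATIVE TWIST MODEL (rank ≤ 1): for every pair (E, p)
of cell (M) (`N10.CellM`: odd additive potentially multiplicative p, E = V ⊗ χ_{p*}) of analytic
rank ≤ 1 and every globally minimal twist model V with C • V^{(p*)} = W (so V is MULTIPLICATIVE at
p), the cell's typed conjecture `QuadraticBranchLowerDivisibilityAt V p` (b2b p10: ϖ·L_p(f_V,
ω^{(p−1)/2}, T) ∣ char_Λ e_{(p−1)/2} X(V/ℚ(μ_{p^∞}))) — the main-conjecture LOWER containment at p ∥
N_V on the ω^{(p−1)/2}-eigenspace (NOT the trivial branch that Skinner 2016 / SU 2014 print; lit g17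
ROUTE-K1-PRIOR-ART §7). Binder `hΛ` of p426893
`Theorems.AdditiveBranchIMCMultLowerCruxShape.multLower_of_facts_of_quadraticBranchLower_of_branchPAdicGrossZagierMult`
(k1-c4's §1/§2 show it is EXACTLY what rank 0 and the Λ-side of rank 1 consume, with no image /
(ram) / μ = 0 hypothesis left over). [difficulty: open-problem] -/
@[route_item "route-BirchSwinnertonDyer-AdditiveBranchIMC"]
def MultLambdaLower : Prop :=
  ∀ (W : WeierstrassCurve ℚ) [W.IsElliptic] [W.IsGloballyMinimal] (p : ℕ) [Fact p.Prime], Summit.BirchSwinnertonDyer.Rank1Residual.Additive.N10.CellM W p → W.analyticRank ≤ 1 → ∀ (V : WeierstrassCurve ℚ) [V.IsElliptic] [V.IsGloballyMinimal], (∃ C : WeierstrassCurve.VariableChange ℚ, C • V.quadraticTwist ((-1) ^ (p / 2) * p : ℚ) = W) → Summit.BirchSwinnertonDyer.Rank1Residual.Additive.QuadraticBranchLowerDivisibilityAt V p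

-- parent: MultLower · child (gen 2)
/--     item stmt-BirchSwinnertonDyer-19591 · crux · rank 406 · open
    parent: MultLower · by operator
    why it might fail: In tree = print + the (M) CLASS CERTIFICATE hCert (A′ ≠ 0 at every rank-1 (M) pair; `multSchneiderNondegeneracy_of_cycLineFact_of_classCert`): certified per pair (booked B6-M rows); class-wide it is Schneider's conjecture on (M), open for every non-CM E — ONE degenerate rank-1 (M) pair breaks the ∀.
    sources: Schneider1985, Schneider1982PadicHeightI, Delbourgo2002, Thm. (B) (Reg_p), Disegni2017, Thm. B (A′ = branch GZ coefficient), MazurTateTeitelbaum1986Invent, §I.13–I.14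
[crux] RANK-1 (M) INPUT 1 — SCHNEIDER NON-DEGENERACY: for every pair (E, p) of cell (M)
(`N10.CellM`: odd additive potentially multiplicative p) of analytic rank 1 and every p-adic height
datum Dh satisfying Delbourgo's leading-term clauses, the cyclotomic p-adic height pairing is
non-degenerate (`SchneiderConjecture Dh`). First conjunct of binder `hGZ` of p426893
`Theorems.AdditiveBranchIMCMultLowerCruxShape.multLower_of_facts_of_quadraticBranchLower_of_branchPAdicGrossZagierMult`
(the binder asks `SchneiderConjecture Dh ∧ BranchPAdicGrossZagierMultAt W p Dh`; split into two
children so that each head constant is item-stated — gate staffability rule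
`undeclared-conjecture`). [deps: MultBranchPAdicGrossZagierAt] [difficulty: open-problem] -/
@[route_item "route-BirchSwinnertonDyer-AdditiveBranchIMC"]
def MultSchneiderNondegeneracy : Prop :=
  ∀ (W : WeierstrassCurve ℚ) [W.IsElliptic] [W.IsGloballyMinimal] (p : ℕ) [Fact p.Prime], Summit.BirchSwinnertonDyer.Rank1Residual.Additive.N10.CellM W p → W.analyticRank = 1 → ∀ Dh : WeierstrassCurve.PAdicHeightData W p, Literature.NumberTheory.EllipticCurves.Delbourgo2002.LeadingTermClauses W p Dh → WeierstrassCurve.SchneiderConjecture Dh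

-- parent: MultLower · child (gen 2)
/--     item stmt-BirchSwinnertonDyer-19586 · support · rank 401 · open
    parent: MultLower · by operator
[support] ALIAS LEAF (cite_only, HELD at birth, never staffed): Delbourgo 1998 Prop. 4 + §2.2 Lemma
(ii) on cell (M): in analytic rank 0 the constant coefficient of the branch p-adic L-function is a
p-adic UNIT multiple of L(E,1)/Ω (exact unit form, potentially multiplicative case) BY NAME — binder
`hDelX` of p426893
`Theorems.AdditiveBranchIMCMultLowerCruxShape.multLower_of_facts_of_quadraticBranchLower_of_branchPAdicGrossZagierMult`;
the published input enters the glue item `MultLowerOfParts` (and so `closes`) as a hypothesis; zero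
proof weight. [cite: Delbourgo1998, Prop. 4, §2.2 Lemma (ii)] [difficulty: cite-only] -/
@[route_item "route-BirchSwinnertonDyer-AdditiveBranchIMC"]
def DelbourgoPotMultUnit : Prop :=
  Literature.NumberTheory.EllipticCurves.Delbourgo1998.prop4_rankZero_constantCoeff_eq_unit_mul_of_potMult

-- parent: MultLower · child (gen 2)
/--     item stmt-BirchSwinnertonDyer-19587 · support · rank 402 · closed · proved by Summit.BirchSwinnertonDyer.BirchSwinnertonDyer.Theorems.additiveBranchIMC_palQuadraticTwistPeriod_holds (prover)
    parent: MultLower · by operator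
[support] ALIAS LEAF (cite_only, HELD at birth, never staffed): Pal 2012 Thm 3.2: √p ·
Ω(E^{(p*)})/Ω(E) ∈ ℚ^× is a p-adic unit up to the explicit power for p ≡ 1 (mod 4) (period
comparison under the quadratic twist by p*; used on the even branch only) BY NAME — binder `hPal` of
p426893
`Theorems.AdditiveBranchIMCMultLowerCruxShape.multLower_of_facts_of_quadraticBranchLower_of_branchPAdicGrossZagierMult`;
the published input enters the glue item `MultLowerOfParts` (and so `closes`) as a hypothesis; zero
proof weight. [cite: Pal2012, Thm. 3.2] [difficulty: cite-only] -/
@[route_item "route-BirchSwinnertonDyer-AdditiveBranchIMC", crux]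
def PalQuadraticTwistPeriod : Prop :=
  Literature.NumberTheory.EllipticCurves.Pal2012.thm32_sqrt_mul_realPeriodRat_twist_eq_of_prime_one_mod_four

-- `PalQuadraticTwistPeriod` holds: proved by `Summit.BirchSwinnertonDyer.BirchSwinnertonDyer.Theorems.additiveBranchIMC_palQuadraticTwistPeriod_holds` (its module imports this route file, so no `_holds` link can be stated here).

-- parent: MultLower · child (gen 2)
/--     item stmt-BirchSwinnertonDyer-19588 · support · rank 403 · open
    parent: MultLower · by operator
[support] ALIAS LEAF (cite_only, HELD at birth, never staffed): Delbourgo 2002 Main Theorem in the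
potentially multiplicative case: leading term of the branch p-adic L-function at additive
potentially multiplicative p (ℒ-invariant form at split V) BY NAME — binder `hDelM` of p426893
`Theorems.AdditiveBranchIMCMultLowerCruxShape.multLower_of_facts_of_quadraticBranchLower_of_branchPAdicGrossZagierMult`;
the published input enters the glue item `MultLowerOfParts` (and so `closes`) as a hypothesis; zero
proof weight. [cite: Delbourgo2002, Theorem (A), (B) (p. 40), pot. mult. case] [difficulty:
cite-only] -/
@[route_item "route-BirchSwinnertonDyer-AdditiveBranchIMC"]
def DelbourgoLeadingTermPotMult : Prop :=
  Literature.NumberTheory.EllipticCurves.Delbourgo2002.mainTheorem_potMult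

-- parent: MultLower · child (gen 2)
/--     item stmt-BirchSwinnertonDyer-19589 · support · rank 404 · open
    parent: MultLower · by operator
[support] ALIAS (HELD at birth, never staffed): the three published inputs Gross–Zagier–Kolyvagin
`rank_eq_analyticRank_of_analyticRank_le_one` ∧ Wiles/BCDT `hasEntireLFunction_rat` ∧
`nonempty_modularParametrizationData`, BY NAME, as ONE conjunction — binders `hGZK`, `hmod`, `hmodD`
of p426893
`Theorems.AdditiveBranchIMCMultLowerCruxShape.multLower_of_facts_of_quadraticBranchLower_of_branchPAdicGrossZagierMult`.
They are ALSO conjuncts 5–7 of `PrintedFacts` (layer-2 items 19921/19273/19266 under it); restated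
jointly here because a split child cannot name a later-rendered route decl and three separate copies
would be three more alias items of this route (gate5 via director-bsd 06:46:54Z). Closes by
`⟨h19921, h19273, h19266⟩`; zero proof weight. [deps: RankEqAnalyticRankLeOne, EntireLFunctionRat,
ModularParametrizationSupply] [difficulty: cite-only] -/
@[route_item "route-BirchSwinnertonDyer-AdditiveBranchIMC"]
def MultModularityInputs : Prop :=
  Literature.NumberTheory.EllipticCurves.rank_eq_analyticRank_of_analyticRank_le_one ∧ WeierstrassCurve.hasEntireLFunction_rat ∧ Literature.NumberTheory.EllipticCurves.ModularForms.nonempty_modularParametrizationData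

-- parent: MultLower · child (gen 2)
/--     item stmt-BirchSwinnertonDyer-19592 · support · rank 407 · open
    parent: MultLower · by operator
    why it might fail: In print on paper (Disegni 2017 Thm B at (E_K, 𝟙_K), semistable v∣p allowed; mult V: Disegni 2022 + Correction; Delbourgo 2002 (B); Nekovář 7.13/7.14 + SplitTwist.correction_eq_zero) but the KERNEL (M) twin of gz's DisegniLine STEP A–C (α = a_p(V) = ±1) is unwritten; fails if (M) calibration errs.
    sources: Disegni2017, Thm. A/B, (1.1.3), Rem. 1.3.2, Delbourgo2002, Thm. (A), (B), GrossZagier1986, Thm. I.(7.3), MazurTateTeitelbaum1986Invent, §I.10, §I.13–I.14, Pal2012, Thm. 3.2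
[crux] RANK-1 (M) INPUT 2 — BRANCH p-ADIC GROSS–ZAGIER AT POTENTIALLY MULTIPLICATIVE p: for every
pair (E, p) of cell (M) of analytic rank 1 and every p-adic height datum Dh satisfying Delbourgo's
leading-term clauses, the cell's typed conjecture `BranchPAdicGrossZagierMultAt W p Dh` (derivative
of the branch p-adic L-function at T = 0 = p-adic height of the Heegner/Kolyvagin generator up to
the printed non-zero factors; T = 0 is NOT an exceptional zero on this branch, split V included —
MTT §I.14, tree `constantCoeff_padicLFunction{Plus,Minus}BranchMult_half`). Second conjunct of
binder `hGZ` of p426893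
`Theorems.AdditiveBranchIMCMultLowerCruxShape.multLower_of_facts_of_quadraticBranchLower_of_branchPAdicGrossZagierMult`;
gz's `PotMultBranchPAdicGrossZagier{,CertIff}` modules give its certificate reading per isogeny
class. [deps: MultSchneiderNondegeneracy] [difficulty: open-problem] -/
@[route_item "route-BirchSwinnertonDyer-AdditiveBranchIMC"]
def MultBranchPAdicGrossZagierAt : Prop :=
  ∀ (W : WeierstrassCurve ℚ) [W.IsElliptic] [W.IsGloballyMinimal] (p : ℕ) [Fact p.Prime], Summit.BirchSwinnertonDyer.Rank1Residual.Additive.N10.CellM W p → W.analyticRank = 1 → ∀ Dh : WeierstrassCurve.PAdicHeightData W p, Literature.NumberTheory.EllipticCurves.Delbourgo2002.LeadingTermClauses W p Dh → Summit.BirchSwinnertonDyer.Rank1Residual.Additive.BranchPAdicGrossZagierMultAt W p Dh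

-- parent: MultLower · glue (gen 2)
/--     item stmt-BirchSwinnertonDyer-19593 · support · rank 408 · closed · proved by Summit.BirchSwinnertonDyer.BirchSwinnertonDyer.Theorems.AdditiveBranchIMCMultLower.multLowerOfParts_proof (prover)
    parent: MultLower · GLUE: children ⟹ parent · by operator
crux-shape seam, ALREADY KERNEL-CHECKED: the children are the 8 binders of k1-c4's landed
Theorems.AdditiveBranchIMCMultLowerCruxShape.multLower_of_facts_of_quadraticBranchLower_of_branchPAdicGrossZagierMult
(p426893), with the three modularity / GZK facts hGZK hmod hmodD bundled into the ONE held alias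
child MultModularityInputs (conjuncts of PrintedFacts, item-stated by RankEqAnalyticRankLeOne /
EntireLFunctionRat / ModularParametrizationSupply) and binder hGZ (SchneiderConjecture Dh AND
BranchPAdicGrossZagierMultAt W p Dh) UNBUNDLED into MultSchneiderNondegeneracy +
MultBranchPAdicGrossZagierAt so that the typed conjecture BranchPAdicGrossZagierMultAt is
item-stated as a head constant (gate staffability rule undeclared-conjecture): 4 HELD by-name
published inputs (Delbourgo 1998 exact unit form on (M), Pal 2012 Thm 3.2, Delbourgo 2002 pot-mult
leading term, the modularity bundle) -> the Lambda-adic lower containment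
QuadraticBranchLowerDivisibilityAt at the MULTIPLICATIVE twist model in rank <= 1 -> Schneider
non-degeneracy on (M) in rank 1 -> branch p-adic Gross-Zagier on (M) in rank 1 => MultLower. A K1
hand closes this glue item with the wrapper "fun h1 h2 h3 h4 h5 hS hGZ => -/
@[route_item "route-BirchSwinnertonDyer-AdditiveBranchIMC"]
def MultLowerOfParts : Prop :=
  DelbourgoPotMultUnit → PalQuadraticTwistPeriod → DelbourgoLeadingTermPotMult → MultModularityInputs → MultLambdaLower → MultSchneiderNondegeneracy → MultBranchPAdicGrossZagierAt → MultLower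

-- `MultLowerOfParts` holds: proved by `Summit.BirchSwinnertonDyer.BirchSwinnertonDyer.Theorems.AdditiveBranchIMCMultLower.multLowerOfParts_proof` (its module imports this route file, so no `_holds` link can be stated here).

/-- item stmt-BirchSwinnertonDyer-19360 · crux · rank 5 · open · by planner
why it might fail: No p-adic L-function interpolating L(E,χ,1) with the right periods is constructed for e ∈ {3,4,6} (Delbourgo 1998 p. 150: the branch object is a piece of Jac X₁(147)); even the UPPER half is a theorem there only on X4 ∧ surj.
sources: Delbourgo1998, Kato2004Asterisque
[crux] (declared RESIDUAL) For every E/ℚ of analytic rank ≤ 1 and every odd additive (G)-ordinary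
prime p of semistability index e ∈ {3,4,6} (p ≥ 5 forced), ord_p #Ш(E)_an ≤ ord_p #Ш(E): the
`CycLeadingTermAt` corner, where E acquires good ordinary reduction only over a cyclic extension of
degree e and Delbourgo's improved L-function is a piece of the Jacobian of X₁(Np), not an
elliptic-curve measure. [difficulty: open-problem] -/
@[route_item "route-BirchSwinnertonDyer-AdditiveBranchIMC", crux]
def GordHigherLower : Prop :=
  ∀ (W : WeierstrassCurve ℚ) [W.IsElliptic] [W.IsGloballyMinimal] (p : ℕ) [Fact p.Prime], W.analyticRank ≤ 1 → Summit.BirchSwinnertonDyer.Rank1Residual.Additive.N10.CellGordHigher W p → Literature.NumberTheory.EllipticCurves.Rank1Residual.Typed.MissingLowerBoundAt W p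

/-- item stmt-BirchSwinnertonDyer-19361 · crux · rank 6 · SPLIT (gen 1) into WuthrichHalfEigenDivisibility, GreenbergVatsalResidualBranch, GreenbergVatsalLiftingRamifiedEven, GreenbergVatsalLiftingEven, DelbourgoPotGoodOrdUnit + glue ReadingFactsOfParts · direct attempts still welcome (low priority) · by planner
why it might fail: a conjunct may be misstated at additive p — e.g. GV (3.12) needs μ(E[p]-branch) = 0 input that p ∤ N supplies via Kato/Ferrero–Washington, and Thm 16's semistability enters through the Néron component group at p.
sources: Wuthrich2014, GreenbergVatsal2000, Delbourgo1998, Kato2004Asterisque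
[crux] The READING inputs of the cell's end states — the four displayed binders that referee A
(pub-bsdpct round 244) flags as a reading of a printed theorem at an ADDITIVE potentially ordinary
prime rather than its verbatim statement — as one conjunction of the tree's named facts: Wuthrich
2014 Thm 16 (half the χ-eigen characteristic ideal divides the cyclotomic prime; printed with p
semistable for E), Greenberg–Vatsal 2000 Thm (3.12) (unit content and λ of the ω^{(p−1)/2}-branch
read off the residual representation; printed for p ∤ N, good ordinary), Greenberg–Vatsal 2000 p. 28
/ p. 30 residual liftings with a prescribed even (ramified) line (printed for good ordinary p ≥ 5),
Delbourgo 1998 Prop 4 in the exact unit form at a potentially good ordinary p (printed as a p-power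
divisibility). Each conjunct is a typed Literature Prop with its cite tag; the item closes by
formalisation of the four readings (or is refuted by one counter-example to a conjunct as typed),
and every one of the cell's 824 booked rank-0 rows is literal-by-name modulo exactly these.
[difficulty: L] -/
@[route_item "route-BirchSwinnertonDyer-AdditiveBranchIMC", crux]
def ReadingFacts : Prop :=
  Literature.NumberTheory.EllipticCurves.Wuthrich2014.thm16_halfEigenCharIdeal_dvd_cyclotomicPrime ∧ Literature.NumberTheory.EllipticCurves.GreenbergVatsal2000.thm312_branch_unitContent_and_lambda_eq_residual_goodOrd ∧ Literature.NumberTheory.EllipticCurves.GreenbergVatsal2000.residualEpsilon_surjOn_of_lineRamifiedEven ∧ Literature.NumberTheory.EllipticCurves.GreenbergVatsal2000.residualEpsilon_surjOn_of_lineEven ∧ Literature.NumberTheory.EllipticCurves.Delbourgo1998.prop4_rankZero_constantCoeff_eq_unit_mul_of_potGoodOrd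

-- parent: ReadingFacts · child (gen 1)
/--     item stmt-BirchSwinnertonDyer-19296 · support · rank 601 · open
    parent: ReadingFacts · by planner
    sources: Wuthrich2014
[support] Wuthrich 2014 Thm 16 (p. 398): for an odd prime p and a character-eigen part, half the
χ-eigen characteristic ideal of the Selmer dual divides the cyclotomic prime (printed with E
semistable at p; read at an additive potentially ordinary p — audit sheet D-AUDIT-hW16) — conjunct
of the crux ReadingFacts (stmt-BirchSwinnertonDyer-19361), BY NAME; same content, filed as a split
child so the head constant is item-stated (gate5 #15c one rule; readiness rule 2026-08-15: cite_only
dep declared by the route; director-bsd 2026-08-26T04:22Z «K3/E2 shape»); the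
reading-at-an-additive-prime caveat (referee A pub-bsdpct R244; cell audit sheets
HOME/audit/D-AUDIT-*.md) stays recorded on the parent; no crux statement / closes / tribunal change -/
@[route_item "route-BirchSwinnertonDyer-AdditiveBranchIMC", crux]
def WuthrichHalfEigenDivisibility : Prop :=
  Literature.NumberTheory.EllipticCurves.Wuthrich2014.thm16_halfEigenCharIdeal_dvd_cyclotomicPrime

-- parent: ReadingFacts · child (gen 1)
/--     item stmt-BirchSwinnertonDyer-19297 · support · rank 602 · open
    parent: ReadingFacts · by planner
    sources: GreenbergVatsal2000
[support] Greenberg–Vatsal 2000 Thm (3.12) (pp. 44–46): unit content and λ-invariant of the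
ω^{(p−1)/2}-branch of the p-adic L-function read off the residual representation (printed for p ∤ N
good ordinary; read on the good-ordinary twist E♭ of an additive index-2 prime — audit sheet
D-AUDIT-hGV) — conjunct of the crux ReadingFacts (stmt-BirchSwinnertonDyer-19361), BY NAME; same
content, filed as a split child so the head constant is item-stated (gate5 #15c one rule; readiness
rule 2026-08-15: cite_only dep declared by the route; director-bsd 2026-08-26T04:22Z «K3/E2 shape»);
the reading-at-an-additive-prime caveat (referee A pub-bsdpct R244; cell audit sheets
HOME/audit/D-AUDIT-*.md) stays recorded on the parent; no crux statement / closes / tribunal change -/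
@[route_item "route-BirchSwinnertonDyer-AdditiveBranchIMC", crux]
def GreenbergVatsalResidualBranch : Prop :=
  Literature.NumberTheory.EllipticCurves.GreenbergVatsal2000.thm312_branch_unitContent_and_lambda_eq_residual_goodOrd

-- parent: ReadingFacts · child (gen 1)
/--     item stmt-BirchSwinnertonDyer-19298 · support · rank 603 · open
    parent: ReadingFacts · by planner
    sources: GreenbergVatsal2000
[support] Greenberg–Vatsal 2000 p. 30 residual lifting with a prescribed RAMIFIED even line (printed
for good ordinary p ≥ 5; audit sheet D-AUDIT-hLiftEF) — conjunct of the crux ReadingFacts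
(stmt-BirchSwinnertonDyer-19361), BY NAME; same content, filed as a split child so the head constant
is item-stated (gate5 #15c one rule; readiness rule 2026-08-15: cite_only dep declared by the route;
director-bsd 2026-08-26T04:22Z «K3/E2 shape»); the reading-at-an-additive-prime caveat (referee A
pub-bsdpct R244; cell audit sheets HOME/audit/D-AUDIT-*.md) stays recorded on the parent; no crux
statement / closes / tribunal change -/
@[route_item "route-BirchSwinnertonDyer-AdditiveBranchIMC"]
def GreenbergVatsalLiftingRamifiedEven : Prop :=
  Literature.NumberTheory.EllipticCurves.GreenbergVatsal2000.residualEpsilon_surjOn_of_lineRamifiedEven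

-- parent: ReadingFacts · child (gen 1)
/--     item stmt-BirchSwinnertonDyer-19299 · support · rank 604 · open
    parent: ReadingFacts · by planner
    sources: GreenbergVatsal2000
[support] Greenberg–Vatsal 2000 p. 28 residual lifting with a prescribed even line (printed for good
ordinary p ≥ 5; audit sheet D-AUDIT-hLiftEF) — conjunct of the crux ReadingFacts
(stmt-BirchSwinnertonDyer-19361), BY NAME; same content, filed as a split child so the head constant
is item-stated (gate5 #15c one rule; readiness rule 2026-08-15: cite_only dep declared by the route;
director-bsd 2026-08-26T04:22Z «K3/E2 shape»); the reading-at-an-additive-prime caveat (referee A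
pub-bsdpct R244; cell audit sheets HOME/audit/D-AUDIT-*.md) stays recorded on the parent; no crux
statement / closes / tribunal change -/
@[route_item "route-BirchSwinnertonDyer-AdditiveBranchIMC", crux]
def GreenbergVatsalLiftingEven : Prop :=
  Literature.NumberTheory.EllipticCurves.GreenbergVatsal2000.residualEpsilon_surjOn_of_lineEven

-- parent: ReadingFacts · child (gen 1)
/--     item stmt-BirchSwinnertonDyer-19300 · support · rank 605 · open
    parent: ReadingFacts · by planner
    sources: Delbourgo1998
[support] Delbourgo 1998 Prop 4 (Compositio 113, p. 139) in the exact UNIT form at a potentially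
good ordinary prime: the constant coefficient of the analytic p-adic L-function equals a p-adic unit
times the BSD quotient in analytic rank 0 (printed as a p-power divisibility; audit sheet
D-AUDIT-hDelG) — conjunct of the crux ReadingFacts (stmt-BirchSwinnertonDyer-19361), BY NAME; same
content, filed as a split child so the head constant is item-stated (gate5 #15c one rule; readiness
rule 2026-08-15: cite_only dep declared by the route; director-bsd 2026-08-26T04:22Z «K3/E2 shape»);
the reading-at-an-additive-prime caveat (referee A pub-bsdpct R244; cell audit sheets
HOME/audit/D-AUDIT-*.md) stays recorded on the parent; no crux statement / closes / tribunal change -/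
@[route_item "route-BirchSwinnertonDyer-AdditiveBranchIMC", crux]
def DelbourgoPotGoodOrdUnit : Prop :=
  Literature.NumberTheory.EllipticCurves.Delbourgo1998.prop4_rankZero_constantCoeff_eq_unit_mul_of_potGoodOrd

-- parent: ReadingFacts · glue (gen 1)
/--     item stmt-BirchSwinnertonDyer-19302 · support · rank 606 · closed · proved by Summit.BirchSwinnertonDyer.BirchSwinnertonDyer.Theorems.AdditiveBranchIMCReadingFactsGlue.readingFactsOfParts_proof (prover)
    parent: ReadingFacts · GLUE: children ⟹ parent · by planner
children = the five cite_only conjuncts of ReadingFacts BY NAME, in conjunct order; glue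
ReadingFactsOfParts : C1 → … → C5 → ReadingFacts is the anonymous constructor
(planner/k1-staffable/AliasSketch.lean readingFactsOfParts_holds, farm rc 0 04:3xZ) -/
@[route_item "route-BirchSwinnertonDyer-AdditiveBranchIMC"]
def ReadingFactsOfParts : Prop :=
  WuthrichHalfEigenDivisibility → GreenbergVatsalResidualBranch → GreenbergVatsalLiftingRamifiedEven → GreenbergVatsalLiftingEven → DelbourgoPotGoodOrdUnit → ReadingFacts

-- `ReadingFactsOfParts` holds: proved by `Summit.BirchSwinnertonDyer.BirchSwinnertonDyer.Theorems.AdditiveBranchIMCReadingFactsGlue.readingFactsOfParts_proof` (its module imports this route file, so no `_holds` link can be stated here).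

/-- item stmt-BirchSwinnertonDyer-19362 · support · rank 9 · SPLIT (gen 1) into GreenbergVatsalNonPrimitiveDatumSelmer, GreenbergNoFiniteSubmodule, GreenbergKummerImageGoodOrdinary, DelbourgoRankZeroDivisibility, RankEqAnalyticRankLeOne, EntireLFunctionRat, ModularParametrizationSupply, BSDQuotientIsogenyInvariance + glue PrintedFactsOfParts · direct attempts still welcome (low priority) · by planner
sources: GreenbergVatsal2000, GreenbergLNM1716, Delbourgo1998, Kato2004Asterisque, MilneADT2006
[support] The inputs of the cell's end states that are VERBATIM IN PRINT, as one conjunction of the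
tree's named facts: Greenberg–Vatsal 2000 Cor (2.3)/Prop (2.4) (non-primitive Selmer invariants at
the datum), Greenberg LNM 1716 Prop 4.14 (no finite Λ-submodule) and Props 2.2/2.4 (Kummer image),
Delbourgo 1998 Prop 4 (weak p-power form), Gross–Zagier–Kolyvagin (rank = r_an ≤ 1, Ш finite),
modularity (entire L-function), existence of a modular parametrisation, Cassels' isogeny invariance
of the BSD quotient. Published theorems, unformalised (referee A: PRE facts); the item closes only
by formalisation. [difficulty: open-problem] -/
@[route_item "route-BirchSwinnertonDyer-AdditiveBranchIMC", crux]
def PrintedFacts : Prop :=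
  Literature.NumberTheory.EllipticCurves.GreenbergVatsal2000.datumSelmer_nonPrimitive_invariants ∧ Literature.NumberTheory.EllipticCurves.Greenberg1999.prop414_noFiniteSubmodule_of_not_dvd_torsionOrder ∧ Literature.NumberTheory.EllipticCurves.Greenberg1999.imKummer_ge_strictCondition_goodOrdinary ∧ Literature.NumberTheory.EllipticCurves.Delbourgo1998.prop4_rankZero_pow_dvd_constantCoeff ∧ Literature.NumberTheory.EllipticCurves.rank_eq_analyticRank_of_analyticRank_le_one ∧ WeierstrassCurve.hasEntireLFunction_rat ∧ Literature.NumberTheory.EllipticCurves.ModularForms.nonempty_modularParametrizationData ∧ WeierstrassCurve.bsdRHS_eq_of_isIsogenous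

-- parent: PrintedFacts · child (gen 1)
/--     item stmt-BirchSwinnertonDyer-19303 · support · rank 901 · open
    parent: PrintedFacts · by operator
    sources: GreenbergVatsal2000
[support] Greenberg–Vatsal 2000 Cor (2.3) / Prop (2.4) (pp. 23–26): μ and λ of the non-primitive
Selmer group at the datum (Σ₀-imprimitive invariants) — conjunct of the support PrintedFacts
(stmt-BirchSwinnertonDyer-19362), BY NAME; same content, filed as a split child so the head constant
is item-stated (gate5 #15c one rule; readiness rule 2026-08-15: cite_only dep declared by the route;
director-bsd 2026-08-26T04:22Z «K3/E2 shape»); no crux statement / closes / tribunal change -/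
@[route_item "route-BirchSwinnertonDyer-AdditiveBranchIMC"]
def GreenbergVatsalNonPrimitiveDatumSelmer : Prop :=
  Literature.NumberTheory.EllipticCurves.GreenbergVatsal2000.datumSelmer_nonPrimitive_invariants

-- parent: PrintedFacts · child (gen 1)
/--     item stmt-BirchSwinnertonDyer-19304 · support · rank 902 · open
    parent: PrintedFacts · by operator
    sources: GreenbergLNM1716
[support] Greenberg LNM 1716 (1999) Prop 4.14 / 4.15 (pp. 94–96): the Selmer dual over ℚ_∞ has no
non-zero finite Λ-submodule when p ∤ #E(ℚ)_tors (good ordinary p) — conjunct of the support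
PrintedFacts (stmt-BirchSwinnertonDyer-19362), BY NAME; same content, filed as a split child so the
head constant is item-stated (gate5 #15c one rule; readiness rule 2026-08-15: cite_only dep declared
by the route; director-bsd 2026-08-26T04:22Z «K3/E2 shape»); no crux statement / closes / tribunal
change -/
@[route_item "route-BirchSwinnertonDyer-AdditiveBranchIMC"]
def GreenbergNoFiniteSubmodule : Prop :=
  Literature.NumberTheory.EllipticCurves.Greenberg1999.prop414_noFiniteSubmodule_of_not_dvd_torsionOrder

-- parent: PrintedFacts · child (gen 1)
/--     item stmt-BirchSwinnertonDyer-19305 · support · rank 903 · open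
    parent: PrintedFacts · by operator
    sources: GreenbergLNM1716
[support] Greenberg LNM 1716 (1999) Props 2.2 / 2.4 (pp. 62–66): the image of the local Kummer map
at a good ordinary prime contains the strict (ordinary) local condition — conjunct of the support
PrintedFacts (stmt-BirchSwinnertonDyer-19362), BY NAME; same content, filed as a split child so the
head constant is item-stated (gate5 #15c one rule; readiness rule 2026-08-15: cite_only dep declared
by the route; director-bsd 2026-08-26T04:22Z «K3/E2 shape»); no crux statement / closes / tribunal
change -/
@[route_item "route-BirchSwinnertonDyer-AdditiveBranchIMC"]
def GreenbergKummerImageGoodOrdinary : Prop :=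
  Literature.NumberTheory.EllipticCurves.Greenberg1999.imKummer_ge_strictCondition_goodOrdinary

-- parent: PrintedFacts · child (gen 1)
/--     item stmt-BirchSwinnertonDyer-19306 · support · rank 904 · open
    parent: PrintedFacts · by operator
    sources: Delbourgo1998
[support] Delbourgo 1998 Prop 4 (Compositio 113, p. 139), verbatim WEAK form: a p-power times the
BSD quotient divides the constant coefficient of the analytic p-adic L-function in analytic rank 0
at a bad (potentially ordinary / multiplicative) prime — conjunct of the support PrintedFacts
(stmt-BirchSwinnertonDyer-19362), BY NAME; same content, filed as a split child so the head constant
is item-stated (gate5 #15c one rule; readiness rule 2026-08-15: cite_only dep declared by the route;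
director-bsd 2026-08-26T04:22Z «K3/E2 shape»); no crux statement / closes / tribunal change -/
@[route_item "route-BirchSwinnertonDyer-AdditiveBranchIMC"]
def DelbourgoRankZeroDivisibility : Prop :=
  Literature.NumberTheory.EllipticCurves.Delbourgo1998.prop4_rankZero_pow_dvd_constantCoeff

-- parent: PrintedFacts · child (gen 1)
/--     item stmt-BirchSwinnertonDyer-19921 · support · rank 905 · open
    parent: PrintedFacts · by operator
    sources: Darmon2004, GrossZagier1986, Kolyvagin1990
[support] The one PUBLISHED input the halves-glue consumes: Gross–Zagier–Kolyvagin, rank = analytic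
rank for analytic rank ≤ 1 with Ш finite (tree named fact
rank_eq_analyticRank_of_analyticRank_le_one; used by bsdp_of_missingPPartAt to turn Miller's last
clause into BSD(E,2)). Carried as a displayed PUB hypothesis; never counted as progress. The further
PRINT of the roads to the two halves (Greenberg Thm-4.1 analogues at a multiplicative prime
thm41Analogue_charValue_rankZero_numberField_anyPrime / …_split_baseChange_anyPrime, modularity) and
the referee-passed MEMO inputs (Kato ⊗ℚ at a multiplicative 2:
X5.O1.KatoMultiplicativeDivisibilityRat W 2, HOME mult/PROOF-MULT.md RC-2; Greenberg–Stevens at 2: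
greenberg_stevens W 2, mult/PROOF-GS2.md RC-4) enter the LINES under the halves (bridge
multiplicativeRankZeroAtTwo_of_muRoad, p409679), not this glue. -/
@[route_item "route-BirchSwinnertonDyer-AdditiveBranchIMC"]
def RankEqAnalyticRankLeOne : Prop :=
  Literature.NumberTheory.EllipticCurves.rank_eq_analyticRank_of_analyticRank_le_one

-- parent: PrintedFacts · child (gen 1)
/--     item stmt-BirchSwinnertonDyer-19273 · support · rank 906 · open
    parent: PrintedFacts · by planner
    sources: BCDTJAMS2001, SilvermanAEC2009
[support] entire continuation of L(E/ℚ, s) (modularity: Breuil–Conrad–Diamond–Taylor 2001 Thm A +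
Hecke/Shimura), BY NAME — conjunct of MultConversePublishedInputsAtTwo (19185); same content, filed
so the head constant is item-stated (#15c one rule; cite_only dep) -/
@[route_item "route-BirchSwinnertonDyer-AdditiveBranchIMC"]
def EntireLFunctionRat : Prop :=
  WeierstrassCurve.hasEntireLFunction_rat

-- parent: PrintedFacts · child (gen 1)
/--     item stmt-BirchSwinnertonDyer-19266 · support · rank 907 · open
    parent: PrintedFacts · by planner
    sources: BCDTJAMS2001
[support] modularity of E/ℚ as parametrisation data (Breuil–Conrad–Diamond–Taylor 2001 Thm A), BY
NAME — conjunct of OrdPublishedInputsAtTwo (19149; Literature.Uncategorized.OrdPublishedInputsAtTwo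
l.26); same content, filed so the head constant is item-stated (#15c one rule; cite_only dep) -/
@[route_item "route-BirchSwinnertonDyer-AdditiveBranchIMC"]
def ModularParametrizationSupply : Prop :=
  Literature.NumberTheory.EllipticCurves.ModularForms.nonempty_modularParametrizationData

-- parent: PrintedFacts · child (gen 1)
/--     item stmt-BirchSwinnertonDyer-19307 · support · rank 908 · open
    parent: PrintedFacts · by operator
    sources: Cassels1965ArithmeticVIII, MilneADT2006
[support] Cassels 1965 (Arithmetic on curves of genus 1, VIII; J. reine angew. Math. 217) / Milne
ADT Thm I.7.3 and Rem I.7.4: the BSD quotient (right-hand side of the BSD formula) is invariant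
under isogeny over ℚ — conjunct of the support PrintedFacts (stmt-BirchSwinnertonDyer-19362), BY
NAME; same content, filed as a split child so the head constant is item-stated (gate5 #15c one rule;
readiness rule 2026-08-15: cite_only dep declared by the route; director-bsd 2026-08-26T04:22Z
«K3/E2 shape»); no crux statement / closes / tribunal change -/
@[route_item "route-BirchSwinnertonDyer-AdditiveBranchIMC"]
def BSDQuotientIsogenyInvariance : Prop :=
  WeierstrassCurve.bsdRHS_eq_of_isIsogenous

-- parent: PrintedFacts · glue (gen 1)
/--     item stmt-BirchSwinnertonDyer-19308 · support · rank 909 · closed · proved by Summit.BirchSwinnertonDyer.BirchSwinnertonDyer.Theorems.AdditiveBranchIMCPrintedFactsGlue.printedFactsOfParts_proof (prover)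
    parent: PrintedFacts · GLUE: children ⟹ parent · by operator
children = the eight cite_only conjuncts of PrintedFacts BY NAME, in conjunct order; glue
PrintedFactsOfParts : C1 → … → C8 → PrintedFacts is the anonymous constructor (AliasSketch.lean
printedFactsOfParts_holds, farm rc 0) -/
@[route_item "route-BirchSwinnertonDyer-AdditiveBranchIMC"]
def PrintedFactsOfParts : Prop :=
  GreenbergVatsalNonPrimitiveDatumSelmer → GreenbergNoFiniteSubmodule → GreenbergKummerImageGoodOrdinary → DelbourgoRankZeroDivisibility → RankEqAnalyticRankLeOne → EntireLFunctionRat → ModularParametrizationSupply → BSDQuotientIsogenyInvariance → PrintedFacts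

-- `PrintedFactsOfParts` holds: proved by `Summit.BirchSwinnertonDyer.BirchSwinnertonDyer.Theorems.AdditiveBranchIMCPrintedFactsGlue.printedFactsOfParts_proof` (its module imports this route file, so no `_holds` link can be stated here).

/-- item stmt-BirchSwinnertonDyer-19363 · support · rank 9 · closed · proved by Summit.BirchSwinnertonDyer.BirchSwinnertonDyer.Theorems.additiveBranchIMC_x3CaseOneRankZero_proof @ 40d6959ede4e (prover) · by planner
sources: GreenbergVatsal2000, Delbourgo1998, Wuthrich2014, MilneADT2006
[support] From the printed and the reading inputs: for every E/ℚ of analytic rank 0 and every odd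
additive (G)-ordinary prime p of semistability index 2 such that some globally minimal curve E′
isogenous to E lies on X3♯(G-ord) with index 2 and carries a Case-1 line datum (`HasCaseOneMember`),
ord_p #Ш(E)_an ≤ ord_p #Ш(E). Provable now: the intrinsic end states
`ClassX3Gord.bsdp_rankZero_of_facts_intrinsic` (p ≥ 5) /
`…bsdp_three_rankZero_of_facts_of_lineDatum_intrinsic` (p = 3) on E′ (analytic rank is an isogeny
invariant, `analyticRank_eq_of_isIsogenous'`), then `N10.missingLowerBoundAt_of_isIsogenous_of_bsdp`
(Cassels). The 824 r0 classes of the member tables are instances (kernel records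
`x3LineDatumThree_<label>` at p = 3). [difficulty: provable-now] -/
@[route_item "route-BirchSwinnertonDyer-AdditiveBranchIMC", crux]
def X3CaseOneRankZero : Prop :=
  PrintedFacts → ReadingFacts → ∀ (W : WeierstrassCurve ℚ) [W.IsElliptic] [W.IsGloballyMinimal] (p : ℕ) [Fact p.Prime], W.analyticRank = 0 → Summit.BirchSwinnertonDyer.Rank1Residual.Additive.N10.CellGordTwo W p → Summit.BirchSwinnertonDyer.Rank1Residual.Additive.HasCaseOneMember W p → Literature.NumberTheory.EllipticCurves.Rank1Residual.Typed.MissingLowerBoundAt W p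

-- `X3CaseOneRankZero` holds: proved by `Summit.BirchSwinnertonDyer.BirchSwinnertonDyer.Theorems.additiveBranchIMC_x3CaseOneRankZero_proof` @ 40d6959ede4e (its module imports this route file, so no `_holds` link can be stated here).

/-- item stmt-BirchSwinnertonDyer-20498 · support · rank 9 · open · by planner
[support] STEP L′ — the BSD-consistent ADJUSTED Heegner-index bound on the non-CM tower-surjective
rank-one (G-ord, e = 2) rows: 2·ord_p[E(K):ℤ·y_K] ≤ ord_p #Ш(E/K) + ord_p ∏c(E) + ord_p ∏c(E^{d_K})
+ 2·ord_p c(Dt) for a Heegner field K (predicted with equality by BSD(E,p) ∧ BSD(E^{d_K},p));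
verbatim the hL' hypothesis of HeegnerKolyvagin.gordTwoRankOne_of_adjustedIndexBound_of_rest (k1-c3x
p536144), which with PUB facts (GZ, Kolyvagin 1990 Thm A, Kato 2004 rank-0 twist bound, GZK,
modularity/newform/parametrisation, Friedberg–Hoffstein, LLT 2024 for CM) and the displayed rest
(X3♯/O8 rows) yields crux GordTwoRankOne (19358). Why it might fail: at p = 3 with ord_3 ∏c(E^{d_K})
≠ ord_3 ∏c(E) only this adjusted form is BSD-consistent (the unadjusted x11b bound is not); per pair
it is decided by ONE McCallum any-level derived-point certificate; no printed refined-Kolyvagin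
statement at an ADDITIVE prime (presearch k1-c3x: W. Zhang 2014 Camb. J. Math. 2, BCGS
arXiv:2312.09301 Thm 2, Sweeting arXiv:2012.11771 are good/multiplicative-prime). Sources: k1-c3x
ROAD-KOLYVAGIN-19358-g0.md §3/§7; arXiv:2312.09301; Kolyvagin 1990 (Grothendieck Festschrift II) Thm
A. Support item (rank 9): not a -/
@[route_item "route-BirchSwinnertonDyer-AdditiveBranchIMC"]
def AdjustedHeegnerIndexBoundTowerSurj : Prop :=
  ∀ (W : WeierstrassCurve ℚ) [W.IsElliptic] [W.IsGloballyMinimal] (p : ℕ) [Fact p.Prime] (N : ℕ) [NeZero N] (K : Type) [Field K] [NumberField K] [DecidableEq K] (Dt : Literature.NumberTheory.EllipticCurves.ModularForms.ModularParametrizationData W N) (H : Literature.NumberTheory.EllipticCurves.HeegnerDatum N (NumberField.discr K)) (ι : K →+* ℂ) (P : (W.baseChange K).toAffine.Point) (Wd : WeierstrassCurve ℚ) [Wd.IsElliptic] [Wd.IsGloballyMinimal] (Cd : WeierstrassCurve.VariableChange ℚ), W.analyticRank = 1 → Summit.BirchSwinnertonDyer.Rank1Residual.Additive.N10.CellGordTwo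 W p → (∀ n : ℕ, W.HasSurjectiveModNGaloisRep (p ^ n : ℕ)) → W.conductorNorm ℤ = N → Literature.NumberTheory.EllipticCurves.IsImaginaryQuadratic K → Literature.NumberTheory.EllipticCurves.SatisfiesHeegnerHypothesis N K → WeierstrassCurve.Affine.Point.map ι.toRatAlgHom P = Literature.NumberTheory.EllipticCurves.ModularForms.heegnerPointComplex Dt H → Cd • W.quadraticTwist (NumberField.discr K : ℚ) = Wd → Finite (W.baseChange K).sha → (2 * padicValNat p (AddSubgroup.zmultiples P).index : ℤ) ≤ padicValNat p (W.baseChange K).shaOrder + padicValNat p W.tamagawaProduct + padicValNat p Wd.tamagawaProduct + 2 * padicValRat p (Dt.c : ℚ)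

/-- item stmt-BirchSwinnertonDyer-23009 · support · rank 9 · open · by planner
[support] (self-twist sub-partition of crux GordTwoRankOne = item 19358; next to 20498; bsd-addord
k1-c3x g5 Part 21c p575175) the Jetchev–Skinner–Wan §7.4.1 (eq:shalower) INDEX BOUND 2·v_p[V(K):ℤP]
≤ v_p #Ш(V/K) + v_p ∏c(V) + v_p ∏c(W) for the GOOD ORDINARY p*-twist V (L(V,1) ≠ 0, ρ̄_{V,p} onto)
of a rank-one cell-(G-ord, e = 2) curve W = Cd • V^{(d_K)}, over K = ℚ(√−p) (d_K = −p, p ≡ 3 mod 4: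
p RAMIFIED in K), at a Manin-good Heegner frame (p ∤ c). With it,
Theorems/…HeegnerKolyvaginSelfTwistFrame
`cellGordTwo_missingLowerBoundAt_rankOne_of_selfTwistIndexBound` gives Typed.MissingLowerBoundAt W p
on those rows from PUBLISHED facts by name (GZ, Kolyvagin, GZK, modularity, Wuthrich Prop 21, Mazur
Cor 4.1, Néron). Status of the input: implied by BSD(V/K) (so not expected refutable as a
statement); as a PROOF TARGET it is open — the JSW / Skinner–Urban / Wan Iwasawa-main-conjecture
arguments over K assume p split (or at least unramified) in K, and the p | d_K case is not in print.
Convention: [DecidableEq K] binder as in 20498. Sources: JetchevSkinnerWan2017 §7.4.1 (eq:shalower)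
pp. 30–31; Kolyvagin1990 Thm A; GrossZagier1986 V.§2; Wuthrich2014 Prop 21. -/
@[route_item "route-BirchSwinnertonDyer-AdditiveBranchIMC"]
def SelfTwistJSWIndexBound : Prop :=
  ∀ (V : WeierstrassCurve ℚ) [V.IsElliptic] [V.IsGloballyMinimal] (p : ℕ) [Fact p.Prime] [NeZero (V.conductorNorm ℤ)] (K : Type) [Field K] [NumberField K] [DecidableEq K] (W : WeierstrassCurve ℚ) [W.IsElliptic] [W.IsGloballyMinimal] (Cd : WeierstrassCurve.VariableChange ℚ) (Dt : Literature.NumberTheory.EllipticCurves.ModularForms.ModularParametrizationData V (V.conductorNorm ℤ)) (H : Literature.NumberTheory.EllipticCurves.HeegnerDatum (V.conductorNorm ℤ) (NumberField.discr K)) (ι : K →+* ℂ) (P : (V.baseChange K).toAffine.Point), V.HasGoodReductionAtPrime p → V.entireLFunction 1 ≠ 0 → V.HasSurjectiveModNGaloisRep p → Literature.NumberTheory.EllipticCurves.IsImaginaryQuadratic K → NumberField.discr K = -(p : ℤ) → Literature.NumberTheory.EllipticCurves.SatisfiesHeegnerHypothesis (V.conductorNorm ℤ) K → Cd • V.quadraticTwist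 (NumberField.discr K : ℚ) = W → W.analyticRank = 1 → Summit.BirchSwinnertonDyer.Rank1Residual.Additive.N10.CellGordTwo W p → WeierstrassCurve.Affine.Point.map ι.toRatAlgHom P = Literature.NumberTheory.EllipticCurves.ModularForms.heegnerPointComplex Dt H → ¬ (p : ℤ) ∣ Dt.c → Finite (V.baseChange K).sha → (2 * padicValNat p (AddSubgroup.zmultiples P).index : ℤ) ≤ padicValNat p (V.baseChange K).shaOrder + padicValNat p V.tamagawaProduct + padicValNat p W.tamagawaProduct

/-- item stmt-BirchSwinnertonDyer-23086 · support · rank 9 · open · by planner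
[support] SUPERSEDES item 23009 SelfTwistJSWIndexBound (misstated at p = 3: unit term missing —
bsd-addord k1-c3x g5 STATUS l.1900; K = ℚ(√−3) has #𝓞_K^× = 6 and Gross–Zagier u² = 9, so the
unit-free inequality fails by exactly 2 at every p = 3 frame where BSD holds). (Self-twist
sub-partition of crux GordTwoRankOne = item 19358; next to 20498.) The Jetchev–Skinner–Wan §7.4.1
(eq:shalower)-type INDEX BOUND WITH THE UNIT TERM: 2·v_p[V(K):ℤP] ≤ v_p #Ш(V/K) + v_p ∏c(V) + v_p
∏c(W) + 2·v_p(w_K) for the GOOD ORDINARY p*-twist V (L(V,1) ≠ 0, ρ̄_{V,p} onto) of a rank-one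
cell-(G-ord, e = 2) curve W = Cd • V^{(d_K)}, over K imaginary quadratic with d_K = −p (p RAMIFIED
in K; p = 3 allowed, the unit term 2·v₃(6) = 2 then enters), at a Manin-good Heegner frame (p ∤ c).
= VERBATIM the hL binder of Theorems/…HeegnerKolyvaginSelfTwistUnitsFrame
`cellGordTwo_missingLowerBoundAt_rankOne_of_selfTwistIndexBoundUnits` (p577019) in route-file
currency ([DecidableEq K] as 20498): with it that theorem gives Typed.MissingLowerBoundAt W p on the
self-twist rows (p ≡ 3 mod 4) from PUBLISHED facts by name (GZ, Kolyvagin, GZK, modularity, Wuthrich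
Prop 21, newforms, Mazur Cor 4.1, Néron). Status: an EQUALIT -/
@[route_item "route-BirchSwinnertonDyer-AdditiveBranchIMC", crux]
def SelfTwistJSWIndexBoundUnits : Prop :=
  ∀ (V : WeierstrassCurve ℚ) [V.IsElliptic] [V.IsGloballyMinimal] (p : ℕ) [Fact p.Prime] [NeZero (V.conductorNorm ℤ)] (K : Type) [Field K] [NumberField K] [DecidableEq K] (W : WeierstrassCurve ℚ) [W.IsElliptic] [W.IsGloballyMinimal] (Cd : WeierstrassCurve.VariableChange ℚ) (Dt : Literature.NumberTheory.EllipticCurves.ModularForms.ModularParametrizationData V (V.conductorNorm ℤ)) (H : Literature.NumberTheory.EllipticCurves.HeegnerDatum (V.conductorNorm ℤ) (NumberField.discr K)) (ι : K →+* ℂ) (P : (V.baseChange K).toAffine.Point), V.HasGoodReductionAtPrime p → V.entireLFunction 1 ≠ 0 → V.HasSurjectiveModNGaloisRep p → Literature.NumberTheory.EllipticCurves.IsImaginaryQuadratic K → NumberField.discr K = -(p : ℤ) → Literature.NumberTheory.EllipticCurves.SatisfiesHeegnerHypothesis (V.conductorNorm ℤ) K → Cd • V.quadraticTwist (NumberField.discr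 K : ℚ) = W → W.analyticRank = 1 → Summit.BirchSwinnertonDyer.Rank1Residual.Additive.N10.CellGordTwo W p → WeierstrassCurve.Affine.Point.map ι.toRatAlgHom P = Literature.NumberTheory.EllipticCurves.ModularForms.heegnerPointComplex Dt H → ¬ (p : ℤ) ∣ Dt.c → Finite (V.baseChange K).sha → (2 * padicValNat p (AddSubgroup.zmultiples P).index : ℤ) ≤ padicValNat p (V.baseChange K).shaOrder + padicValNat p V.tamagawaProduct + padicValNat p W.tamagawaProduct + 2 * padicValNat p (NumberField.Units.torsionOrder K)

/-- item stmt-BirchSwinnertonDyer-19364 · assembly · rank 1 · closed · proved by Summit.BirchSwinnertonDyer.BirchSwinnertonDyer.Theorems.additiveBranchIMC_assembly_proof @ 40d6959ede4e (prover) · by planner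
sources: Miller2011LMS, Delbourgo1998
[assembly] PrintedFacts → ReadingFacts → X3CaseOneRankZero → GordTwoRankZeroOffCaseOne →
GordTwoRankOne → MultLower → GordHigherLower → AdditiveOrdinaryLowerHalf -/
@[route_item "route-BirchSwinnertonDyer-AdditiveBranchIMC", crux]
def Assembly : Prop :=
  PrintedFacts → ReadingFacts → X3CaseOneRankZero → GordTwoRankZeroOffCaseOne → GordTwoRankOne → MultLower → GordHigherLower → Summit.BirchSwinnertonDyer.Rank1Residual.Additive.AdditiveOrdinaryLowerHalf

-- `Assembly` holds: proved by `Summit.BirchSwinnertonDyer.BirchSwinnertonDyer.Theorems.additiveBranchIMC_assembly_proof` @ 40d6959ede4e (its module imports this route file, so no `_holds` link can be stated here).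

/-! D-0027 §2.1 — DECIDING THEOREM (planner-authored via `route open/edit --closes-file`; by planner-bsd-addord-plan-g12-0 2026-08-26T00:38:58Z):
its hypotheses are this route's items and its conclusion the registered leaf `Summit.BirchSwinnertonDyer.Rank1Residual.Additive.AdditiveOrdinaryLowerHalf` (rung K1, D-0061) (glue_lint), and it elaborates with this file. -/

@[closes "route-BirchSwinnertonDyer-AdditiveBranchIMC"] theorem closes (h₀ : PrintedFacts) (h₀' : ReadingFacts) (h₁ : X3CaseOneRankZero) (h₂ : GordTwoRankZeroOffCaseOne)
    (h₃ : GordTwoRankOne) (h₄ : MultLower) (h₅ : GordHigherLower) (hA : Assembly) :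
    Summit.BirchSwinnertonDyer.Rank1Residual.Additive.AdditiveOrdinaryLowerHalf :=
  hA h₀ h₀' h₁ h₂ h₃ h₄ h₅

end Summit.BirchSwinnertonDyer.BirchSwinnertonDyer.Theses.AdditiveBranchIMC
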